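import Mathlib
import Literature.MathematicalPhysics.QuantumFieldTheory.Balaban1983to89.Beta.VectorTailsCov
import Literature.MathematicalPhysics.QuantumFieldTheory.Balaban1983to89.B5

/-!
# (W3a)₀ vector road, node VECTOR-TAILS-PROP12 — the (1.110)/(1.126) READINGS of the covariant
# propagator `𝒢 = Δ_a⁻¹` on the tree's operators, the block envelopes of the parametrix sources,
# and the value / first-difference legs `d0`, `d1` PER BASE POINT, uniform in the instance

Unit `b2b-balaban-beta-an1` (β sub-cell, analysis prover AN1), gen 7.  Third file of the node,
after `Beta/VectorTails.lean` (abstract Newton-parametrix dictionary; the `ℤ^d` and torus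
parametrix) and `Beta/VectorTailsCov.lean` (its realisation on `B5DeltaA169.DeltaA` /
`B5Prop11Plancherel.calG`; torus distances; rate loss).

HONEST FRAMING.  Discharging `BetaPertH` would make Bałaban's ultraviolet stability UNCONDITIONAL —
a constructive-QFT result; it is NOT the continuum limit and NOT the Clay problem.  This file is
kernel bookkeeping towards ONE hypothesis binder (`hFtail`/`hGtail` of `Beta/ComposedRoad`) of the
cell's (W3a)₀ vector road.  NOTHING PRINTED IS ASSERTED: the displayed inequalities (1.110)–(1.114)
of [B5, Prop. 1.2, pp. 35–36] enter ONLY as the hypothesis `B5.Prop12Printed (fam …)` BY NAME,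
read on the concrete carrier `setting` (§1), and (1.126)–(1.127) of [B5, p. 38] ONLY as the
hypothesis `B5.Kernel126_127Printed (kfam …)` BY NAME, read on the concrete carrier `kernelData`
(§2); both stay binders of every theorem that uses them (beta-ref R-g31-1 (d)) and neither is
discharged anywhere.  Every declaration is [folklore]: finite sums, sup norms, the triangle
inequality and the two companion files; 0 sorry, 0 cited facts.

[B5] = [Balaban1984PropagatorsI] T. Bałaban, *Propagators and renormalization transformations for
lattice gauge theories. I*, Comm. Math. Phys. 95 (1984) 17–40.

## Main results (all MODULO the two named printed hypotheses)

* `legs_uniform` (§7): for `d ≥ 3`,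
  `Prop12Printed (fam …) → Kernel126_127Printed (kfam …) → ∃ δ > 0, ∃ A₀ A₁ ≥ 0, ∀ i, ∀ bonds,`
  `d0 : ‖𝒢((x,κ),(x₀,ν₀))‖ ≤ A₀ η² e^{-(δ/n)·tdist x₀ x} / nrm(liftZ (x − x₀))^{d−2}` and
  `d1 : ‖𝒢((x+e_μ,κ),(x₀,ν₀)) − 𝒢((x,κ),(x₀,ν₀))‖ ≤ A₁ η² e^{-(δ/n)·tdist x₀ x} / nrm(…)^{d−1}`,
  for EVERY instance `i ↦ (n, M)` of the consumer's family (no side condition), `η = 1/n`,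
  `nrm v = max 1 ‖v‖_∞`, `tdist x₀ x = ‖liftZ (x − x₀)‖_∞` (circular sup distance).  At `d = 4`
  these are the `d0`/`d1` rows of `Beta/SquareTable` §13 PER BASE POINT `(x₀, ν₀)` in the
  torus-intrinsic separation; the `ℤ⁴`-indexing / annulus convention of the consumer's
  `Gf n : Pt → ℝ` is one `liftZ` away and is the consumer adapter's.
* `entry_bound` (§4) / `entry_diff_bound` (§5): the same with an explicit cutoff radius `m`,
  `1 ≤ m ≤ n ≤ R m`, `6m + 6 ≤ n M_μ`; `value_and_difference_legs` (§6): one rate for both;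
  `entry_bound_small` / `entry_diff_bound_small` (§7): bounded `n ≤ N₀` from (1.110) alone.
* `locBound_of_prop12` (§1), `dPd_bound_of_kernel126` (§2): the two readings unpacked into the
  (1.110)-SHAPE `VectorTails.LocBound` + its gradient twin `GradBound`, and the entry bound
  `|∂P∂*((x,κ),(x',ν))| ≤ C η^d e^{-δ₀' tdist(x,x')/n}`.
* §3: block envelopes `‖(·)|_{block y'}‖ ≤ K e^{-δ' tdist(y', blk x₀)}` of the three parametrix
  sources `ρ`, `aQ*Q H`, `∂P∂* H` (`resid_envelope`, `aQQ_envelope`, `dPd_envelope`).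

## Mechanism (why the constants are `n`-free although (1.110) on a point source loses `η^{-d}`)

Newton parametrix `H = δ_{κν₀} h_{x₀}` of radius `m ≍ n/12` (`VectorTails` §2–§3:
`Δ_𝕋 h = n²(δ_{x₀} − ρ)`, `|h| ≤ C₀/nrm^{d−2}`, `|∇h| ≤ C/nrm^{d−1}`, `Σ|h| ≤ C m²`,
`|ρ| ≤ Cρ/m^d`, supports in the `3m`-cube); entry identity
`𝒢((x,κ),(x₀,ν₀)) = (𝒢ρ)(x,κ) + n⁻² (H(x,κ) − (𝒢 V H)(x,κ))`, `V = Δ_a − Δ = −∂P∂* + aQ*Q`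
(`VectorTailsCov` §2), and its shifted difference (§5, `shiftDiff_entry_eq`).  The sources have
block envelopes with `Kρ = O(m^{-d})`, `n⁻² K_V = O(m² η^{d+2})`, i.e. `O(η^d)` in total once
`n ≤ R m` (`remainder_consts_le`); (1.110) in `LocBound`/`GradBound` shape sums them against the
VOLUME-UNIFORM `Σ_{y'} e^{-(δ₀/2) tdist(y,y')} ≤ S` (`VectorTailsCov.sum_exp_tdist_le`), giving a
remainder `O(η^d) e^{-δ₁ tdist_blk}` (`O(η^{d+1})` for the difference, `GradBound` carrying the
factor `n`), converted to the profile by `e^{-δ₁ t_blk} ≤ e^{δ₁} e^{-δ₁‖v‖_∞/n}`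
(`exp_block_le_exp_fine`) and the rate loss `η^{k+2} e^{-δ₁ r/n} ≤ c η² r^{-k} e^{-(δ₁/2) r/n}`
(`VectorTailsCov.rate_loss`, `remainder_profile`); the singular part `n⁻²|h|`, `n⁻²|∇h|` IS the
profile on the `3m`-cube (torus transport of the unit step,
`VectorTails.liftZ_add_castT(_not_mem)`).

## §1 The (1.110) reading (`setting`, `fam`, `locBound_of_prop12`)

`B5.Setting` is the tree's ABSTRACT carrier of Props 1.1–1.2.  We read it on the torus
`T_η = Tor (fine n M)` (η = n⁻¹, unit lattice `Tor M`) as follows — every choice makes the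
resulting instance of (1.110) WEAKER than (implied by) the faithful reading, so that the hypothesis
`Prop12Printed (fam …)` asks no more than the printed sentence, up to the d-dependent constant
relating the component sup norm to the fibre sup norm (factor `≤ √d`, absorbed in the printed
O(1), which is existentially quantified):
* `Site := Tor M` (unit cubes Δ(y) ↔ blocks `B5Blocks16.blockOf n M · = y`),
  `dist y y' := tdist y y'` = the circular SUP distance (≤ the Euclidean one, so
  `e^{-δ₀ tdist} ≥ e^{-δ₀|y-y'|}`: weaker);
* `Loc := Tor (fine n M) × Fin d → ℂ` (vector sources), `suppIn J y' :=` "J vanishes off the block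
  of y'" (a block is contained in the doubled cube Δ̃(y'), so this is a SMALLER class of sources);
* `supNorm J := ‖J‖` (component sup norm ≤ fibre sup norm);
* `e 0 J y := blockSup (𝒢 J) y` = max over the block of y and the components of `|(𝒢J)(x, κ)|`
  (≤ sup over Δ̃(y) of the fibre norm), `e 1 J y :=` the same for the forward η-differences
  `n((𝒢J)(x + e_μ, κ) − (𝒢J)(x, κ))` (the U = 1 covariant derivative), `e 2 = e 3 := 0`, and every
  Hölder / cut-off / L² slot `:= 0`: blocks 2, 4, 5 of `Ineq110_114` then read `0 ≤ 0` and block 3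
  reads `0 ≤ Cε(ε) e^{…} ‖J‖`, true for the printed `O(1)(ε) ≥ 0` (a witness may be taken `≥ 0`
  without loss), so they carry no information.
The family index `ι` and the map `i ↦ (n i, M i)` are the CONSUMER's (Bałaban's family is
(k, T_η), η = L^{-k}): `fam` does not enlarge the printed family.  The identification of the tree's
`calG = (B5DeltaA169.DeltaA)⁻¹` (`calG_mul_DeltaA`) with the `G = Δ_a⁻¹` (1.71) of Prop. 1.2 is the
tree's (`B5DeltaA169`); it is part of the READING the referee cross-reads, not a theorem.

## NOT certified here (scope statement)

(i) Neither printed hypothesis is discharged: (1.110)–(1.114) is [B5, Prop. 1.2] (proof for G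
"very sketchy", pp. 36–40, GAPS C-B5-6) and (1.126)–(1.127) is the by-method import of [B5, p. 38]
(GAPS C-B5-6 r1 / G-B5-06a); both remain binders.  (ii) The second-difference leg `d2` is NOT
here: per base point it is not reachable from the printed displays (beta-ref R-g31-1 (a)); the
block-averaged `d2` needs `∇ρ = O(m^{-d-1})`, i.e. a C² cutoff in `VectorTails` §2 — next
generation.  (iii) The readings `setting` / `kernelData` are the referee's cross-read items
(component vs fibre norms; `η^d`-density kernel convention of §2).  (iv) Nothing here is the
continuum limit or Clay.  R-g31-1 compliance: (a) no per-base-point `d2`; (b) rate loss and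
block-vs-fine distance are kernel lemmas (`VectorTailsCov` §5–§6, used in §4–§7); (c) the block
sum `hS` is volume-uniform (`sum_exp_tdist_le`); (d) `Kernel126_127Printed` is a NAMED binder.
-/

open Finset Matrix
open scoped BigOperators ComplexConjugate Matrix

namespace Literature.MathematicalPhysics.QuantumFieldTheory.Balaban1983to89.Beta.VectorTailsLoc

open Literature.MathematicalPhysics.QuantumFieldTheory.Balaban1983to89.B5Prop11Plancherel
open Literature.MathematicalPhysics.QuantumFieldTheory.Balaban1983to89.B5Prop11Lower
open Literature.MathematicalPhysics.QuantumFieldTheory.Balaban1983to89.B5Action121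
open Literature.MathematicalPhysics.QuantumFieldTheory.Balaban1983to89.B5Block118
open Literature.MathematicalPhysics.QuantumFieldTheory.Balaban1983to89.B5Value126
open Literature.MathematicalPhysics.QuantumFieldTheory.Balaban1983to89.B5DeltaA169
open Literature.MathematicalPhysics.QuantumFieldTheory.Balaban1983to89.Beta.VectorTails
open Literature.MathematicalPhysics.QuantumFieldTheory.Balaban1983to89.Beta.VectorTailsCov
open Literature.MathematicalPhysics.QuantumFieldTheory.Balaban1983to89.Beta.PoissonInterior

/-! ## §1 The (1.110) reading of `𝒢` -/

section Setting

variable {d : ℕ} (n : ℕ) [NeZero n] (M : Fin d → ℕ) [hM : ∀ μ, NeZero (M μ)]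

/-- `blockSup F y` = the maximum of `‖F (x, κ)‖` over the block of `y` (all `x` with
`blockOf x = y`, all components `κ`); `0` if the index type is empty. [folklore] -/
noncomputable def blockSup (F : Tor (fine n M) × Fin d → ℂ) (y : Tor M) : ℝ :=
  ⨆ p : {p : Tor (fine n M) × Fin d // B5Blocks16.blockOf n M p.1 = y}, ‖F p.1‖

/-- every value on the block is below the block sup. [folklore] -/
theorem norm_le_blockSup (F : Tor (fine n M) × Fin d → ℂ) (p : Tor (fine n M) × Fin d) :
    ‖F p‖ ≤ blockSup n M F (B5Blocks16.blockOf n M p.1) := by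
  unfold blockSup
  exact le_ciSup (f := fun q : {q : Tor (fine n M) × Fin d //
      B5Blocks16.blockOf n M q.1 = B5Blocks16.blockOf n M p.1} => ‖F q.1‖)
    (Finite.bddAbove_range _) ⟨p, rfl⟩

/-- the forward η-difference in direction `μ`, scaled by `n = η⁻¹` (the U = 1 covariant
derivative of a vector function, componentwise): `n (F(x + e_μ, κ) − F(x, κ))`. [folklore] -/
noncomputable def fdiff (F : Tor (fine n M) × Fin d → ℂ) (μ : Fin d) :
    Tor (fine n M) × Fin d → ℂ :=
  fun p => (n : ℂ) * (F (p.1 + unitVec (fine n M) μ, p.2) - F p)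

variable (hn : 1 ≤ n) (a : ℝ) (ha : 0 < a)

/-- `e 0 J y` := block sup of `|(𝒢 J)(x, κ)|` over the block of `y`. [folklore] -/
noncomputable def e0 (J : Tor (fine n M) × Fin d → ℂ) (y : Tor M) : ℝ :=
  blockSup n M (calG n hn M a ha *ᵥ J) y

/-- `e 1 J y` := max over directions of the block sup of the forward η-differences of `𝒢 J`.
[folklore] -/
noncomputable def e1 (J : Tor (fine n M) × Fin d → ℂ) (y : Tor M) : ℝ :=
  ⨆ μ : Fin d, blockSup n M (fdiff n M (calG n hn M a ha *ᵥ J) μ) y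

/-- a first difference is below `e 1`. [folklore] -/
theorem norm_fdiff_le_e1 (J : Tor (fine n M) × Fin d → ℂ) (p : Tor (fine n M) × Fin d)
    (μ : Fin d) :
    ‖fdiff n M (calG n hn M a ha *ᵥ J) μ p‖ ≤ e1 n M hn a ha J (B5Blocks16.blockOf n M p.1) := by
  refine (norm_le_blockSup n M _ p).trans ?_
  unfold e1
  exact le_ciSup (f := fun μ : Fin d =>
    blockSup n M (fdiff n M (calG n hn M a ha *ᵥ J) μ) (B5Blocks16.blockOf n M p.1))
    (Finite.bddAbove_range _) μ

/-- **The (1.110) reading of `𝒢 = Δ_a⁻¹` on the tree's operators** (see the module docstring for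
why each slot is a weakening of the faithful reading).  The Hölder, cut-off and L² slots are `0`:
the corresponding clauses of `B5.Ineq110_114` are not used on this road. [folklore] -/
noncomputable def setting : B5.Setting where
  Site := Tor M
  dist := fun y y' => (tdist y y' : ℝ)
  k := 0
  Loc := Tor (fine n M) × Fin d → ℂ
  suppIn := fun J y' => ∀ z : Tor (fine n M) × Fin d, B5Blocks16.blockOf n M z.1 ≠ y' → J z = 0
  supNorm := fun J => ‖J‖
  l2Norm := fun _ => 0
  holder := fun _ _ => 0
  Cut := PUnit
  cutIn := fun _ _ => True
  cutH := fun _ _ => 0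
  cutSup := fun _ => 0
  l2op := fun _ _ => 0
  e := fun m J y => ![e0 n M hn a ha J y, e1 n M hn a ha J y, 0, 0] m
  h1 := fun _ _ _ => 0
  e4 := fun _ _ => 0
  h2 := fun _ _ _ => 0
  l2loc := fun _ _ _ => 0
  Vec := PUnit
  formΔa := fun _ => 0
  formΔI := fun _ => 0

/-- **Gradient twin of `VectorTails.LocBound`** for `𝒢`: the (1.110) bound for the forward
η-differences of `𝒢 J`, `J` supported in one block. A `Prop`-valued SHAPE. [folklore] -/
def GradBound (C δ₀ : ℝ) : Prop :=
  ∀ (J : Tor (fine n M) × Fin d → ℂ) (y' : Tor M),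
    (∀ z : Tor (fine n M) × Fin d, B5Blocks16.blockOf n M z.1 ≠ y' → J z = 0) →
    ∀ (p : Tor (fine n M) × Fin d) (μ : Fin d),
      ‖fdiff n M (calG n hn M a ha *ᵥ J) μ p‖ ≤
        C * Real.exp (-(δ₀ * (tdist (B5Blocks16.blockOf n M p.1) y' : ℝ))) * ‖J‖

end Setting

section Family

variable {d : ℕ} {ι : Type} (nOf : ι → ℕ) [hn0 : ∀ i, NeZero (nOf i)] (hn1 : ∀ i, 1 ≤ nOf i)
  (MOf : ι → Fin d → ℕ) [hM0 : ∀ i μ, NeZero (MOf i μ)] (a : ℝ) (ha : 0 < a)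

/-- the CONSUMER-indexed family of readings `i ↦ setting (n i) (M i)` (Bałaban's family index is
(k, T_η), η = L^{-k}; the map `i ↦ (n i, M i)` is the consumer's, so `Prop12Printed (fam …)` does
not enlarge the printed family). [folklore] -/
noncomputable def fam : ι → B5.Setting := fun i => setting (nOf i) (MOf i) (hn1 i) a ha

/-- **(1.110) BY NAME ⇒ the `LocBound` shape and its gradient twin**, with the printed
quantifier order (δ₀, C before the instance). [folklore] -/
theorem locBound_of_prop12 (h : B5.Prop12Printed (fam nOf hn1 MOf a ha)) :
    ∃ δ₀ C : ℝ, 0 < δ₀ ∧ 0 < C ∧ ∀ i : ι,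
      LocBound (calG (nOf i) (hn1 i) (MOf i) a ha)
          (fun p : Tor (fine (nOf i) (MOf i)) × Fin d => B5Blocks16.blockOf (nOf i) (MOf i) p.1)
          (fun y y' => (tdist y y' : ℝ)) C δ₀ ∧
        GradBound (nOf i) (MOf i) (hn1 i) a ha C δ₀ := by
  obtain ⟨δ₀, C, Cα, Cε, Cαε, hδ, hC, hall⟩ := h
  refine ⟨δ₀, C, hδ, hC, fun i => ⟨fun J y' hJ p => ?_, fun J y' hJ p μ => ?_⟩⟩
  · have h0 := (hall i).1 0 J (B5Blocks16.blockOf (nOf i) (MOf i) p.1) y' hJ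
    exact (norm_le_blockSup (nOf i) (MOf i) _ p).trans h0
  · have h1 := (hall i).1 1 J (B5Blocks16.blockOf (nOf i) (MOf i) p.1) y' hJ
    exact (norm_fdiff_le_e1 (nOf i) (MOf i) (hn1 i) a ha J p μ).trans h1

end Family

/-! ## §2 The (1.126) reading of `∂P∂*` -/

section Kernel

variable {d : ℕ} (n : ℕ) [NeZero n] (M : Fin d → ℕ) [hM : ∀ μ, NeZero (M μ)]

/-- `∂P∂*` on the tree's operators: `GradOp · PcT · GradOpᴴ` (the non-local zeroth-order part of
`Δ_a`, cf. `VectorTailsCov.Vop = -dPd + a • Q*Q`). [folklore] -/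
noncomputable def dPd : Matrix (Tor (fine n M) × Fin d) (Tor (fine n M) × Fin d) ℂ :=
  GradOp (fine n M) (n : ℂ) * PcT n M (n : ℂ) * (GradOp (fine n M) (n : ℂ))ᴴ

/-- `V = -∂P∂* + a Q*Q` (definitional). [folklore] -/
theorem Vop_eq (a : ℝ) : Vop n M a = -dPd n M + (a : ℂ) • (QvAdj n M * QvOp n M) := rfl

/-- the maximum over components of `|(∂P∂*)((x,κ),(x',ν))|` (a MATRIX entry). [folklore] -/
noncomputable def kerSup (x x' : Tor (fine n M)) : ℝ :=
  ⨆ κν : Fin d × Fin d, ‖dPd n M (x, κν.1) (x', κν.2)‖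

/-- each component is below the maximum. [folklore] -/
theorem norm_dPd_le_kerSup (x : Tor (fine n M)) (κ : Fin d) (x' : Tor (fine n M)) (ν : Fin d) :
    ‖dPd n M (x, κ) (x', ν)‖ ≤ kerSup n M x x' :=
  le_ciSup (f := fun κν : Fin d × Fin d => ‖dPd n M (x, κν.1) (x', κν.2)‖)
    (Finite.bddAbove_range _) (κ, ν)

/-- the EUCLIDEAN length of the centred lift, `edist x x' = ‖liftZ (x' − x)‖₂` (fine-lattice units).
[folklore] -/
noncomputable def edist {N : Fin d → ℕ} (x x' : Tor N) : ℝ :=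
  Real.sqrt (∑ μ, (((liftZ (x' - x)) μ : ℤ) : ℝ) ^ 2)

omit [NeZero n] hM in
/-- `edist ≥ 0`. [folklore] -/
theorem edist_nonneg {N : Fin d → ℕ} (x x' : Tor N) : 0 ≤ edist x x' := Real.sqrt_nonneg _

omit [NeZero n] hM in
/-- the circular sup distance is at most the Euclidean one: `tdist ≤ edist`. [folklore] -/
theorem tdist_le_edist {N : Fin d → ℕ} (x x' : Tor N) : (tdist x x' : ℝ) ≤ edist x x' := by
  rcases Nat.eq_zero_or_pos d with hd | hd
  · subst hd
    have : tdist x x' = 0 := by simp [tdist, supNorm]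
    rw [this, Nat.cast_zero]; exact Real.sqrt_nonneg _
  · exact supNorm_le_sqrt hd _

/-- **The (1.126) reading of `∂P∂*` on the tree's operators.**  [B5] writes operators on `T_η`
through η^d-WEIGHTED sums, `(P f)(x) = Σ_{x'} η^d P(x, x') f(x')` (as in (1.20), (1.21)), whereas
the tree's matrices act by the unweighted `mulVec`; the tree's `QsOp`/`QvOp` ((1.20)/(1.18):
entries `η^d`, `η^{d+1}`), `Lap` (= `η⁻²` × graph Laplacian) and `GradOp … n` (η-scaled
differences) represent Bałaban's `Q'`, `Q`, `Δ`, `∂` AS LINEAR MAPS, and `PcT =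
Δ⁻¹Q'ᴴ(Q'Δ⁻²Q'ᴴ)⁻¹Q'Δ⁻¹` represents his `P` whichever adjoint convention is used for `Q'*`
(a scalar factor in `Q'*` cancels between the outer `Q'*` and the inverted middle factor), while
`∂* = ∂ᴴ` (equal weights on both sides).  Hence the tree's MATRIX ENTRY of `∂P∂*` is `η^d ×`
the printed KERNEL, and `|x − x'|` of (1.126) is the η-lattice distance in unit-cube units,
`= (fine lattice distance)·η`, read as the EUCLIDEAN length of the centred lift (`edist`, so that
the side condition `|x − x'| ≤ 1` and the factor `|x − x'|^α` of (1.127) are the printed ones).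
So `ker x x' := n^d · max_{κν} |dPd((x,κ),(x',ν))|`, `dist x x' := edist x x' / n`; the clause
(1.127) so read is implied by the printed one componentwise (`|max|a| − max|b|| ≤ max|a − b|`)
and is NOT used below.  This convention is the one the referee is asked to cross-read against
[B5, p. 38]; the hypothesis `Kernel126_127Printed (kfam …)` is carried BY NAME and never
discharged here. [folklore] -/
noncomputable def kernelData : B5.KernelData where
  X := Tor (fine n M)
  dist := fun x x' => edist x x' / n
  ker := fun x x' => (n : ℝ) ^ d * kerSup n M x x'

end Kernel

section KFamily

variable {d : ℕ} {ι : Type} (nOf : ι → ℕ) [hn0 : ∀ i, NeZero (nOf i)]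
  (MOf : ι → Fin d → ℕ) [hM0 : ∀ i μ, NeZero (MOf i μ)]

/-- the consumer-indexed family of kernel readings. [folklore] -/
noncomputable def kfam : ι → B5.KernelData := fun i => kernelData (nOf i) (MOf i)

/-- **(1.126) BY NAME ⇒ the entry bound `|∂P∂*((x,κ),(x',ν))| ≤ C η^d e^{-δ₀' tdist(x,x')/n}`**,
with the printed quantifier order. [folklore] -/
theorem dPd_bound_of_kernel126 (h : B5.Kernel126_127Printed (kfam nOf MOf)) :
    ∃ δ₀' C : ℝ, 0 < δ₀' ∧ 0 < C ∧ ∀ (i : ι) (x : Tor (fine (nOf i) (MOf i))) (κ : Fin d)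
      (x' : Tor (fine (nOf i) (MOf i))) (ν : Fin d),
      ‖dPd (nOf i) (MOf i) (x, κ) (x', ν)‖ ≤
        C / ((nOf i : ℕ) : ℝ) ^ d * Real.exp (-(δ₀' * (tdist x x' : ℝ) / (nOf i : ℕ))) := by
  obtain ⟨δ₀', C, Cα, hδ, hC, hall⟩ := h
  refine ⟨δ₀', C, hδ, hC, fun i x κ x' ν => ?_⟩
  have hk := (hall i).1 x x'
  have hn : (0 : ℝ) < ((nOf i : ℕ) : ℝ) := Nat.cast_pos.mpr (NeZero.pos _)
  have hnpos : (0 : ℝ) < ((nOf i : ℕ) : ℝ) ^ d := pow_pos hn d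
  have h0 : C * Real.exp (-(δ₀' * (edist x x' / (nOf i : ℕ)))) ≤
      C * Real.exp (-(δ₀' * ((tdist x x' : ℝ) / (nOf i : ℕ)))) := by
    refine mul_le_mul_of_nonneg_left (Real.exp_le_exp.mpr (neg_le_neg ?_)) hC.le
    exact mul_le_mul_of_nonneg_left (div_le_div_of_nonneg_right (tdist_le_edist x x') hn.le) hδ.le
  have h1 : ((nOf i : ℕ) : ℝ) ^ d * kerSup (nOf i) (MOf i) x x' ≤
      C * Real.exp (-(δ₀' * ((tdist x x' : ℝ) / (nOf i : ℕ)))) :=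
    ((le_abs_self _).trans hk).trans h0
  have h2 : kerSup (nOf i) (MOf i) x x' ≤
      C / ((nOf i : ℕ) : ℝ) ^ d * Real.exp (-(δ₀' * (tdist x x' : ℝ) / (nOf i : ℕ))) := by
    rw [div_mul_eq_mul_div, le_div_iff₀ hnpos, mul_comm]
    simpa [mul_div_assoc] using h1
  exact (norm_dPd_le_kerSup (nOf i) (MOf i) x κ x' ν).trans h2

end KFamily

/-! ## §3 The block envelopes of the parametrix sources `ρ`, `aQ*Q H`, `∂P∂* H` -/

section Envelopes

open Literature.MathematicalPhysics.QuantumFieldTheory.Balaban1983to89.Beta.PoissonInterior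

variable {d : ℕ} (n : ℕ) [NeZero n] (M : Fin d → ℕ) [hM : ∀ μ, NeZero (M μ)]

omit [NeZero n] hM in
/-- a column has the size of its scalar. [folklore] -/
theorem norm_colOf_le (f : Tor (fine n M) → ℝ) (ν₀ : Fin d) (z : Tor (fine n M) × Fin d) :
    ‖colOf n M f ν₀ z‖ ≤ |f z.1| := by
  rw [colOf_apply]
  split_ifs
  · rw [Complex.norm_real, Real.norm_eq_abs]
  · rw [norm_zero]; exact abs_nonneg _

omit [NeZero n] hM in
/-- a column vanishes where its scalar does. [folklore] -/
theorem colOf_ne_zero {f : Tor (fine n M) → ℝ} {ν₀ : Fin d} {z : Tor (fine n M) × Fin d}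
    (h : colOf n M f ν₀ z ≠ 0) : f z.1 ≠ 0 := by
  intro hf
  apply h
  rw [colOf_apply, hf]
  simp

omit [NeZero n] hM in
/-- a non-zero value of `A H` has a non-zero term. [folklore] -/
theorem exists_of_mulVec_ne_zero {X : Type*} [Fintype X] (A : Matrix X X ℂ) (H : X → ℂ)
    (z : X) (h : (A *ᵥ H) z ≠ 0) : ∃ p, A z p ≠ 0 ∧ H p ≠ 0 := by
  obtain ⟨p, -, hp⟩ := Finset.exists_ne_zero_of_sum_ne_zero h
  exact ⟨p, mul_ne_zero_iff.mp hp⟩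

omit [NeZero n] in
/-- the support of `Q*Q` in block terms: a non-zero entry `(Q*Q)(z, i')` is witnessed by a bond
`b` with `Q(b, z) ≠ 0 ≠ Q(b, i')`. [folklore] -/
theorem exists_of_QQ_ne_zero (z i' : Tor (fine n M) × Fin d)
    (h : (QvAdj n M * QvOp n M) z i' ≠ 0) :
    ∃ b : Tor M × Fin d, QvOp n M b z ≠ 0 ∧ QvOp n M b i' ≠ 0 := by
  rw [Matrix.mul_apply] at h
  obtain ⟨b, -, hb⟩ := Finset.exists_ne_zero_of_sum_ne_zero h
  obtain ⟨h1, h2⟩ := mul_ne_zero_iff.mp hb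
  refine ⟨b, ?_, h2⟩
  intro hz
  apply h1
  simp [QvAdj, Matrix.smul_apply, Matrix.conjTranspose_apply, hz]

/-- FINE SUPPORT RADIUS ⇒ BLOCK SUPPORT RADIUS: `‖x - x₀‖_∞ ≤ k n ⇒ tdist (blk x₀) (blk x) ≤ k`.
[folklore] -/
theorem tdist_blockOf_le_of_supNorm_le {x₀ x : Tor (fine n M)} {k : ℕ}
    (h : supNorm (liftZ (x - x₀)) ≤ k * n) :
    tdist (B5Blocks16.blockOf n M x₀) (B5Blocks16.blockOf n M x) ≤ k := by
  have h2 := (supNorm_liftZ_sub_le n M x x₀).2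
  have hn : 1 ≤ n := NeZero.one_le
  set t := tdist (B5Blocks16.blockOf n M x₀) (B5Blocks16.blockOf n M x) with ht
  by_contra hlt
  have hk : k + 1 ≤ t := by omega
  have h3 : n * (k + 1) ≤ n * t := Nat.mul_le_mul_left n hk
  have h4 : n * k + n ≤ k * n + (n - 1) := by
    have := h3.trans (h2.trans (Nat.add_le_add_right h _))
    rw [Nat.mul_succ] at this
    exact this
  rw [Nat.mul_comm k n] at h4
  have h5 : n ≤ n - 1 := Nat.le_of_add_le_add_left h4
  omega

/-- FINE DECAY ⇒ BLOCK DECAY: `e^{-δ tdist(x₀,x)/n} ≤ e^{δ} e^{-δ tdist(blk x, blk x₀)}`.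
[folklore] -/
theorem exp_fine_le_exp_block {δ : ℝ} (hδ : 0 ≤ δ) (x₀ x : Tor (fine n M)) :
    Real.exp (-(δ * (tdist x₀ x : ℝ) / n)) ≤ Real.exp δ *
      Real.exp (-(δ * (tdist (B5Blocks16.blockOf n M x) (B5Blocks16.blockOf n M x₀) : ℝ))) := by
  have h2 := (supNorm_liftZ_sub_le n M x x₀).2
  rw [tdist_comm (B5Blocks16.blockOf n M x)]
  set t := tdist (B5Blocks16.blockOf n M x₀) (B5Blocks16.blockOf n M x) with ht
  have hn : (0 : ℝ) < n := Nat.cast_pos.mpr (NeZero.pos n)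
  have hn1 : 1 ≤ n := NeZero.one_le
  have e1 : ((n * t : ℕ) : ℝ) ≤ ((supNorm (liftZ (x - x₀)) + (n - 1) : ℕ) : ℝ) := Nat.cast_le.mpr h2
  rw [Nat.cast_mul, Nat.cast_add, Nat.cast_sub hn1, Nat.cast_one] at e1
  have e2 : (t : ℝ) ≤ (tdist x₀ x : ℝ) / n + 1 := by
    rw [div_add_one hn.ne', le_div_iff₀ hn]
    have : (tdist x₀ x : ℝ) = (supNorm (liftZ (x - x₀)) : ℝ) := rfl
    rw [this]; linarith
  rw [← Real.exp_add]
  refine Real.exp_le_exp.mpr ?_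
  have e3 : δ * (t : ℝ) ≤ δ * ((tdist x₀ x : ℝ) / n + 1) := mul_le_mul_of_nonneg_left e2 hδ
  rw [mul_add, mul_one] at e3
  rw [mul_div_assoc]
  linarith

/-- BLOCK DECAY ⇒ FINE DECAY: `e^{-δ tdist(blk x, blk x₀)} ≤ e^{δ} e^{-δ tdist(x₀,x)/n}`.
[folklore] -/
theorem exp_block_le_exp_fine {δ : ℝ} (hδ : 0 ≤ δ) (x x₀ : Tor (fine n M)) :
    Real.exp (-(δ * (tdist (B5Blocks16.blockOf n M x) (B5Blocks16.blockOf n M x₀) : ℝ))) ≤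
      Real.exp δ * Real.exp (-(δ * (tdist x₀ x : ℝ) / n)) := by
  rw [← Real.exp_add, tdist_comm]
  refine Real.exp_le_exp.mpr ?_
  have hn : (0 : ℝ) < n := Nat.cast_pos.mpr (NeZero.pos n)
  have hn1 : 1 ≤ n := NeZero.one_le
  have h1 := (supNorm_liftZ_sub_le n M x x₀).1
  have e1 : (tdist x₀ x : ℝ) ≤ (n : ℝ) *
      (tdist (B5Blocks16.blockOf n M x₀) (B5Blocks16.blockOf n M x) : ℝ) + ((n : ℝ) - 1) := by
    have := (Nat.cast_le (α := ℝ)).mpr h1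
    rw [Nat.cast_add, Nat.cast_mul, Nat.cast_sub hn1, Nat.cast_one] at this
    exact this
  have e2 : δ * (tdist x₀ x : ℝ) / n ≤
      δ * (tdist (B5Blocks16.blockOf n M x₀) (B5Blocks16.blockOf n M x) : ℝ) + δ := by
    rw [div_le_iff₀ hn]
    have := mul_le_mul_of_nonneg_left e1 hδ
    nlinarith only [this, hδ, hn]
  linarith only [e2]

omit [NeZero n] hM in
/-- a column difference has the size of its scalar difference. [folklore] -/
theorem norm_colOf_sub_le (f : Tor (fine n M) → ℝ) (ν₀ : Fin d) (x x' : Tor (fine n M))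
    (κ : Fin d) : ‖colOf n M f ν₀ (x', κ) - colOf n M f ν₀ (x, κ)‖ ≤ |f x' - f x| := by
  simp only [colOf_apply]
  split_ifs
  · rw [← Complex.ofReal_sub, Complex.norm_real, Real.norm_eq_abs]
  · rw [sub_zero, norm_zero]; exact abs_nonneg _

/-- **Envelope of the residual column**: `|ρ| ≤ C_ρ m^{-d}` on blocks within `tdist ≤ 3` of the
block of `x₀` (for `m ≤ n`), zero beyond; in the exponential form consumed by
`VectorTails.norm_entry_le_of_parametrix`, for any rate `δ' ≥ 0`. [folklore] -/
theorem resid_envelope (hd : 3 ≤ d) : ∃ Cρ : ℝ, 0 ≤ Cρ ∧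
    ∀ (n : ℕ) [NeZero n] (M : Fin d → ℕ) [∀ μ, NeZero (M μ)] (m : ℕ), 1 ≤ m → m ≤ n →
      ∀ (x₀ : Tor (fine n M)) (ν₀ : Fin d) (δ' : ℝ), 0 ≤ δ' → ∀ y' : Tor M,
        ‖restrictBlk (fun p : Tor (fine n M) × Fin d => B5Blocks16.blockOf n M p.1)
            (colResid n M m x₀ ν₀) y'‖ ≤
          Cρ / (m : ℝ) ^ d * Real.exp (δ' * 3) *
            Real.exp (-(δ' * (tdist y' (B5Blocks16.blockOf n M x₀) : ℝ))) := by
  obtain ⟨Cρ, hCρ, hρ⟩ := abs_residT_le (d := d) hd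
  refine ⟨Cρ, hCρ, fun n _ M _ m hm hmn x₀ ν₀ δ' hδ' y' => ?_⟩
  refine norm_restrictBlk_le_envelope (dist := fun y y' : Tor M => (tdist y y' : ℝ))
    (y₀ := B5Blocks16.blockOf n M x₀) (ℓ := 3) (by positivity) hδ' (fun z => ?_) (fun z hz => ?_) y'
  · exact (norm_colOf_le n M _ ν₀ z).trans (hρ (fine n M) m hm x₀ z.1)
  · have h1 : residT m x₀ z.1 ≠ 0 := colOf_ne_zero n M hz
    have h2 : liftZ (z.1 - x₀) ∈ cube (0 : (Fin d → ℤ)) (3 * m) := by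
      by_contra hmem; exact h1 (residT_eq_zero_of_not_mem hm hmem)
    have h3 : supNorm (liftZ (z.1 - x₀)) ≤ 3 * n :=
      (mem_cube_zero_iff.mp h2).trans (Nat.mul_le_mul_left 3 hmn)
    have h4 := tdist_blockOf_le_of_supNorm_le n M h3
    rw [tdist_comm] at h4
    exact_mod_cast h4

/-- **Envelope of the block-averaging part `aQ*Q H` of the source**: `≤ a C m² η^d` on blocks
within `tdist ≤ 5` of the block of `x₀` (for `m ≤ n`), zero beyond. [folklore] -/
theorem aQQ_envelope (hd : 3 ≤ d) {a : ℝ} (ha : 0 ≤ a) : ∃ C : ℝ, 0 ≤ C ∧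
    ∀ (n : ℕ) [NeZero n] (M : Fin d → ℕ) [∀ μ, NeZero (M μ)] (m : ℕ), 1 ≤ m → m ≤ n →
      ∀ (x₀ : Tor (fine n M)) (ν₀ : Fin d) (δ' : ℝ), 0 ≤ δ' → ∀ y' : Tor M,
        ‖restrictBlk (fun p : Tor (fine n M) × Fin d => B5Blocks16.blockOf n M p.1)
            ((((a : ℂ) • (QvAdj n M * QvOp n M)) *ᵥ colParam n M m x₀ ν₀)) y'‖ ≤
          a * (C * (m : ℝ) ^ 2) / (n : ℝ) ^ d * Real.exp (δ' * 5) *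
            Real.exp (-(δ' * (tdist y' (B5Blocks16.blockOf n M x₀) : ℝ))) := by
  obtain ⟨C, hC, hsum⟩ := sum_abs_paramT_le (d := d) hd
  refine ⟨C, hC, fun n _ M _ m hm hmn x₀ ν₀ δ' hδ' y' => ?_⟩
  refine norm_restrictBlk_le_envelope (dist := fun y y' : Tor M => (tdist y y' : ℝ))
    (y₀ := B5Blocks16.blockOf n M x₀) (ℓ := 5) (by positivity) hδ' (fun z => ?_) (fun z hz => ?_) y'
  · refine (norm_aQQ_colOf_le n M ha (paramT m x₀) ν₀ z).trans ?_
    rw [mul_assoc, mul_div_assoc]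
    refine mul_le_mul_of_nonneg_left ?_ ha
    rw [div_eq_mul_one_div (C * (m : ℝ) ^ 2), mul_comm (C * (m : ℝ) ^ 2)]
    exact mul_le_mul_of_nonneg_left (hsum (fine n M) m hm x₀) (by positivity)
  · rw [Matrix.smul_mulVec, Pi.smul_apply, smul_ne_zero_iff] at hz
    obtain ⟨i', hQQ, hH⟩ := exists_of_mulVec_ne_zero _ _ z hz.2
    obtain ⟨b, hbz, hbi⟩ := exists_of_QQ_ne_zero n M z i' hQQ
    have t1 : tdist b.1 (B5Blocks16.blockOf n M z.1) ≤ 1 :=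
      tdist_blockOf_le_one_of_QvOp_ne_zero n M b.1 b.2 z.1 z.2 hbz
    have t2 : tdist b.1 (B5Blocks16.blockOf n M i'.1) ≤ 1 :=
      tdist_blockOf_le_one_of_QvOp_ne_zero n M b.1 b.2 i'.1 i'.2 hbi
    have h1 : paramT m x₀ i'.1 ≠ 0 := colOf_ne_zero n M hH
    have h2 : liftZ (i'.1 - x₀) ∈ cube (0 : (Fin d → ℤ)) (3 * m - 1) := by
      by_contra hmem; exact h1 (paramT_eq_zero_of_not_mem hm hmem)
    have h3 : supNorm (liftZ (i'.1 - x₀)) ≤ 3 * n :=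
      (mem_cube_zero_iff.mp h2).trans ((Nat.sub_le _ _).trans (Nat.mul_le_mul_left 3 hmn))
    have t3 := tdist_blockOf_le_of_supNorm_le n M h3
    have tri1 := tdist_triangle (B5Blocks16.blockOf n M z.1) b.1 (B5Blocks16.blockOf n M x₀)
    have tri2 := tdist_triangle b.1 (B5Blocks16.blockOf n M i'.1) (B5Blocks16.blockOf n M x₀)
    rw [tdist_comm] at t1
    rw [tdist_comm] at t3
    have : tdist (B5Blocks16.blockOf n M z.1) (B5Blocks16.blockOf n M x₀) ≤ 5 := by omega
    exact_mod_cast this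

/-- **Envelope of the non-local part `∂P∂* H` of the source** from an entry bound of (1.126)
shape (`dPd_bound_of_kernel126`): `≤ C_K C₁ m² η^d e^{4δ₀'} e^{-δ₀' tdist(y', blk x₀)}`
(for `m ≤ n`). [folklore] -/
theorem dPd_envelope (hd : 3 ≤ d) : ∃ C₁ : ℝ, 0 ≤ C₁ ∧
    ∀ (n : ℕ) [NeZero n] (M : Fin d → ℕ) [∀ μ, NeZero (M μ)] (CK δ₀' : ℝ), 0 ≤ CK → 0 ≤ δ₀' →
      (∀ (x : Tor (fine n M)) (κ : Fin d) (x' : Tor (fine n M)) (ν : Fin d),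
          ‖dPd n M (x, κ) (x', ν)‖ ≤
            CK / (n : ℝ) ^ d * Real.exp (-(δ₀' * (tdist x x' : ℝ) / n))) →
      ∀ (m : ℕ), 1 ≤ m → m ≤ n → ∀ (x₀ : Tor (fine n M)) (ν₀ : Fin d) (y' : Tor M),
        ‖restrictBlk (fun p : Tor (fine n M) × Fin d => B5Blocks16.blockOf n M p.1)
            (dPd n M *ᵥ colParam n M m x₀ ν₀) y'‖ ≤
          CK * (C₁ * (m : ℝ) ^ 2) / (n : ℝ) ^ d * Real.exp (δ₀' * 4) *
            Real.exp (-(δ₀' * (tdist y' (B5Blocks16.blockOf n M x₀) : ℝ))) := by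
  obtain ⟨C₁, hC₁, hsum⟩ := sum_abs_paramT_le (d := d) hd
  refine ⟨C₁, hC₁, fun n _ M _ CK δ₀' hCK hδ hK m hm hmn x₀ ν₀ y' => ?_⟩
  have hn : (0 : ℝ) < n := Nat.cast_pos.mpr (NeZero.pos n)
  set E := Real.exp (-(δ₀' * (tdist y' (B5Blocks16.blockOf n M x₀) : ℝ))) with hE
  have hRHS : 0 ≤ CK * (C₁ * (m : ℝ) ^ 2) / (n : ℝ) ^ d * Real.exp (δ₀' * 4) * E := by
    positivity
  refine (pi_norm_le_iff_of_nonneg hRHS).mpr fun z => ?_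
  by_cases hz : B5Blocks16.blockOf n M z.1 = y'
  swap
  · rw [show restrictBlk (fun p : Tor (fine n M) × Fin d => B5Blocks16.blockOf n M p.1)
        (dPd n M *ᵥ colParam n M m x₀ ν₀) y' z = 0 from if_neg hz, norm_zero]
    exact hRHS
  simp only [restrictBlk, hz, if_true]
  -- the fine envelope at `z`
  have step1 : ‖(dPd n M *ᵥ colParam n M m x₀ ν₀) z‖ ≤
      ∑ p, CK / (n : ℝ) ^ d * Real.exp (δ₀' * 3) *
        Real.exp (-(δ₀' * (tdist x₀ z.1 : ℝ) / n)) * ‖colParam n M m x₀ ν₀ p‖ := by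
    simp only [Matrix.mulVec, dotProduct]
    refine (norm_sum_le _ _).trans (Finset.sum_le_sum fun p _ => ?_)
    rw [norm_mul]
    by_cases hp : colParam n M m x₀ ν₀ p = 0
    · rw [hp, norm_zero, mul_zero, mul_zero]
    refine mul_le_mul_of_nonneg_right ?_ (norm_nonneg _)
    have h1 : paramT m x₀ p.1 ≠ 0 := colOf_ne_zero n M hp
    have h2 : liftZ (p.1 - x₀) ∈ cube (0 : (Fin d → ℤ)) (3 * m - 1) := by
      by_contra hmem; exact h1 (paramT_eq_zero_of_not_mem hm hmem)
    have h3 : supNorm (liftZ (p.1 - x₀)) ≤ 3 * n :=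
      (mem_cube_zero_iff.mp h2).trans ((Nat.sub_le _ _).trans (Nat.mul_le_mul_left 3 hmn))
    have h4 : (tdist x₀ p.1 : ℝ) ≤ 3 * n := by
      have : tdist x₀ p.1 = supNorm (liftZ (p.1 - x₀)) := rfl
      rw [this]; exact_mod_cast h3
    have tri : (tdist z.1 x₀ : ℝ) ≤ tdist z.1 p.1 + tdist p.1 x₀ := by
      exact_mod_cast tdist_triangle z.1 p.1 x₀
    rw [tdist_comm p.1 x₀] at tri
    have hKz := hK z.1 z.2 p.1 p.2
    simp only [Prod.mk.eta] at hKz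
    refine hKz.trans ?_
    rw [mul_assoc]
    refine mul_le_mul_of_nonneg_left ?_ (by positivity)
    rw [← Real.exp_add]
    refine Real.exp_le_exp.mpr ?_
    rw [tdist_comm x₀ z.1]
    have e1 : δ₀' * (tdist z.1 x₀ : ℝ) / n ≤ δ₀' * (tdist z.1 p.1 : ℝ) / n + δ₀' * 3 := by
      have : δ₀' * (tdist z.1 x₀ : ℝ) / n ≤ δ₀' * ((tdist z.1 p.1 : ℝ) + 3 * n) / n := by
        refine div_le_div_of_nonneg_right (mul_le_mul_of_nonneg_left (by linarith) hδ) hn.le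
      refine this.trans (le_of_eq ?_)
      field_simp
    linarith
  -- sum the `ℓ¹` size of the column
  have step2 : ∑ p, CK / (n : ℝ) ^ d * Real.exp (δ₀' * 3) *
        Real.exp (-(δ₀' * (tdist x₀ z.1 : ℝ) / n)) * ‖colParam n M m x₀ ν₀ p‖ ≤
      CK / (n : ℝ) ^ d * Real.exp (δ₀' * 3) *
        Real.exp (-(δ₀' * (tdist x₀ z.1 : ℝ) / n)) * (C₁ * (m : ℝ) ^ 2) := by
    rw [← Finset.mul_sum]
    refine mul_le_mul_of_nonneg_left ?_ (by positivity)
    rw [colParam, sum_norm_colOf]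
    exact hsum (fine n M) m hm x₀
  -- fine decay ⇒ block decay
  have step3 := exp_fine_le_exp_block n M hδ x₀ z.1
  rw [hz] at step3
  refine step1.trans (step2.trans ?_)
  have e4 : Real.exp (δ₀' * 4) = Real.exp (δ₀' * 3) * Real.exp δ₀' := by
    rw [← Real.exp_add]; ring_nf
  rw [e4]
  have hA : 0 ≤ CK / (n : ℝ) ^ d * Real.exp (δ₀' * 3) * (C₁ * (m : ℝ) ^ 2) := by positivity
  calc CK / (n : ℝ) ^ d * Real.exp (δ₀' * 3) * Real.exp (-(δ₀' * (tdist x₀ z.1 : ℝ) / n))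
        * (C₁ * (m : ℝ) ^ 2)
      = CK / (n : ℝ) ^ d * Real.exp (δ₀' * 3) * (C₁ * (m : ℝ) ^ 2)
        * Real.exp (-(δ₀' * (tdist x₀ z.1 : ℝ) / n)) := by ring
    _ ≤ CK / (n : ℝ) ^ d * Real.exp (δ₀' * 3) * (C₁ * (m : ℝ) ^ 2) * (Real.exp δ₀' * E) :=
        mul_le_mul_of_nonneg_left step3 hA
    _ = CK * (C₁ * (m : ℝ) ^ 2) / (n : ℝ) ^ d * (Real.exp (δ₀' * 3) * Real.exp δ₀') * E := by
        ring

omit [NeZero n] hM in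
/-- block restriction is additive. [folklore] -/
theorem restrictBlk_add {X Y : Type*} [DecidableEq Y] (blk : X → Y) (f g : X → ℂ) (y : Y) :
    restrictBlk blk (f + g) y = restrictBlk blk f y + restrictBlk blk g y := by
  funext z
  simp only [restrictBlk, Pi.add_apply]
  split_ifs <;> simp

omit [NeZero n] hM in
/-- block restriction commutes with negation. [folklore] -/
theorem restrictBlk_neg {X Y : Type*} [DecidableEq Y] (blk : X → Y) (f : X → ℂ) (y : Y) :
    restrictBlk blk (-f) y = -restrictBlk blk f y := by
  funext z
  simp only [restrictBlk, Pi.neg_apply]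
  split_ifs <;> simp

end Envelopes

/-! ## §4 The value leg `d0` PER BASE POINT: the entry bound for `𝒢 = Δ_a⁻¹` modulo (1.110) and
(1.126) BY NAME -/

section Profile

/-- **Remainder ⇒ profile.** `B η^d e^{-δ₁ r/n} ≤ B (1 + ((d-2)/(δ₁/2))^{d-2}) η² e^{-(δ₁/2) r/n} /
max(1,r)^{d-2}` for `r = 0` or `r ≥ 1` (`VectorTailsCov.rate_loss` with `k = d - 2`). [folklore] -/
theorem remainder_profile {d : ℕ} (hd : 3 ≤ d) {δ₁ N r B : ℝ} (hδ₁ : 0 < δ₁) (hN : 1 ≤ N)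
    (hB : 0 ≤ B) (hr : r = 0 ∨ 1 ≤ r) :
    B * (1 / N) ^ d * Real.exp (-(δ₁ * r / N)) ≤
      B * (1 + (((d - 2 : ℕ) : ℝ) / (δ₁ / 2)) ^ (d - 2)) * (1 / N) ^ 2 *
        Real.exp (-(δ₁ / 2 / N) * r) / max 1 r ^ (d - 2) := by
  have hNpos : 0 < N := lt_of_lt_of_le one_pos hN
  have hd2 : 1 ≤ d - 2 := by omega
  have hsplit : (1 / N) ^ d = (1 / N) ^ (d - 2) * (1 / N) ^ 2 := by
    rw [← pow_add, Nat.sub_add_cancel (by omega : 2 ≤ d)]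
  have hK0 : (0 : ℝ) ≤ (((d - 2 : ℕ) : ℝ) / (δ₁ / 2)) ^ (d - 2) := by positivity
  rcases hr with hr0 | hr1
  · subst hr0
    rw [max_eq_left (zero_le_one : (0 : ℝ) ≤ 1), one_pow, div_one, mul_zero, mul_zero, zero_div,
      neg_zero, Real.exp_zero, mul_one, mul_one]
    have h1 : (1 / N) ^ d ≤ (1 / N) ^ 2 := by
      rw [hsplit]
      refine mul_le_of_le_one_left (by positivity) ?_
      exact pow_le_one₀ (by positivity) (by rw [div_le_one hNpos]; exact hN)
    calc B * (1 / N) ^ d = B * 1 * (1 / N) ^ d := by ring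
      _ ≤ B * (1 + (((d - 2 : ℕ) : ℝ) / (δ₁ / 2)) ^ (d - 2)) * (1 / N) ^ 2 :=
          mul_le_mul (mul_le_mul_of_nonneg_left (le_add_of_nonneg_right hK0) hB) h1
            (by positivity) (by positivity)
  · have hrpos : 0 < r := lt_of_lt_of_le one_pos hr1
    rw [max_eq_right hr1]
    have key := rate_loss hd2 (half_lt_self hδ₁) hNpos hrpos
    rw [show δ₁ - δ₁ / 2 = δ₁ / 2 by ring] at key
    have hE : Real.exp (-(δ₁ / 2 * r / N)) = Real.exp (-(δ₁ / 2 / N) * r) := by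
      congr 1; ring
    rw [hE, Nat.sub_add_cancel (by omega : 2 ≤ d)] at key
    calc B * (1 / N) ^ d * Real.exp (-(δ₁ * r / N))
        = B * ((1 / N) ^ d * Real.exp (-(δ₁ * r / N))) := by ring
      _ ≤ B * ((((d - 2 : ℕ) : ℝ) / (δ₁ / 2)) ^ (d - 2) *
            ((1 / N) ^ 2 * (1 / r) ^ (d - 2) * Real.exp (-(δ₁ / 2 / N) * r))) :=
          mul_le_mul_of_nonneg_left key hB
      _ ≤ B * ((1 + (((d - 2 : ℕ) : ℝ) / (δ₁ / 2)) ^ (d - 2)) *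
            ((1 / N) ^ 2 * (1 / r) ^ (d - 2) * Real.exp (-(δ₁ / 2 / N) * r))) :=
          mul_le_mul_of_nonneg_left (mul_le_mul_of_nonneg_right
            (le_add_of_nonneg_left zero_le_one) (by positivity)) hB
      _ = B * (1 + (((d - 2 : ℕ) : ℝ) / (δ₁ / 2)) ^ (d - 2)) * (1 / N) ^ 2 *
            Real.exp (-(δ₁ / 2 / N) * r) / r ^ (d - 2) := by
          rw [one_div r, inv_pow]; ring

/-- **The remainder constants are `≤ B η^d`** once `1 ≤ m ≤ n ≤ R m`: `Cρ/m^d ≤ Cρ R^d η^d` and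
`η² m² ≤ 1`. [folklore] -/
theorem remainder_consts_le (d : ℕ) {N mR R Cρ CK C₁ CQ a δ₀' : ℝ} (hN : 0 < N) (hm : 0 < mR)
    (hmN : mR ≤ N) (hRm : N ≤ R * mR) (hCρ : 0 ≤ Cρ) (hCK : 0 ≤ CK) (hC₁ : 0 ≤ C₁) (hCQ : 0 ≤ CQ)
    (ha : 0 ≤ a) :
    Cρ / mR ^ d * Real.exp (δ₀' * 3) + (1 / N) ^ 2 *
      (CK * (C₁ * mR ^ 2) / N ^ d * Real.exp (δ₀' * 4)
        + a * (CQ * mR ^ 2) / N ^ d * Real.exp (δ₀' * 5)) ≤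
      (Cρ * Real.exp (δ₀' * 3) * R ^ d + (CK * C₁ * Real.exp (δ₀' * 4)
          + a * CQ * Real.exp (δ₀' * 5))) * (1 / N) ^ d := by
  rw [add_mul]
  refine add_le_add ?_ ?_
  · have h1 : 1 / mR ^ d ≤ R ^ d * (1 / N) ^ d := by
      rw [div_pow, one_pow, ← div_eq_mul_one_div,
        div_le_div_iff₀ (by positivity) (by positivity), one_mul, ← mul_pow]
      exact pow_le_pow_left₀ hN.le hRm d
    calc Cρ / mR ^ d * Real.exp (δ₀' * 3)
        = Cρ * Real.exp (δ₀' * 3) * (1 / mR ^ d) := by ring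
      _ ≤ Cρ * Real.exp (δ₀' * 3) * (R ^ d * (1 / N) ^ d) :=
          mul_le_mul_of_nonneg_left h1 (by positivity)
      _ = Cρ * Real.exp (δ₀' * 3) * R ^ d * (1 / N) ^ d := by ring
  · have h1 : (1 / N) ^ 2 * mR ^ 2 ≤ 1 := by
      rw [div_pow, one_pow, div_mul_eq_mul_div, one_mul, div_le_one (by positivity)]
      exact pow_le_pow_left₀ hm.le hmN 2
    have hNd : (1 / N) ^ d = (N ^ d)⁻¹ := by rw [div_pow, one_pow, one_div]
    have e : (1 / N) ^ 2 * (CK * (C₁ * mR ^ 2) / N ^ d * Real.exp (δ₀' * 4)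
          + a * (CQ * mR ^ 2) / N ^ d * Real.exp (δ₀' * 5))
        = ((1 / N) ^ 2 * mR ^ 2) *
          ((CK * C₁ * Real.exp (δ₀' * 4) + a * CQ * Real.exp (δ₀' * 5)) * (1 / N) ^ d) := by
      rw [hNd]; ring
    rw [e]
    calc ((1 / N) ^ 2 * mR ^ 2) *
          ((CK * C₁ * Real.exp (δ₀' * 4) + a * CQ * Real.exp (δ₀' * 5)) * (1 / N) ^ d)
        ≤ 1 * ((CK * C₁ * Real.exp (δ₀' * 4) + a * CQ * Real.exp (δ₀' * 5)) * (1 / N) ^ d) :=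
          mul_le_mul_of_nonneg_right h1 (by positivity)
      _ = _ := one_mul _

end Profile

section Assembly

open Literature.MathematicalPhysics.QuantumFieldTheory.Balaban1983to89.Beta.PoissonInterior

variable {d : ℕ} {ι : Type} (nOf : ι → ℕ) [hn0 : ∀ i, NeZero (nOf i)] (hn1 : ∀ i, 1 ≤ nOf i)
  (MOf : ι → Fin d → ℕ) [hM0 : ∀ i μ, NeZero (MOf i μ)] (a : ℝ) (ha : 0 < a)

/-- **THE VALUE LEG OF THE COVARIANT PROPAGATOR, PER BASE POINT (d0 shape).**  For `d ≥ 3` and a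
ratio bound `R ≥ 1`: ASSUMING [B5, (1.110)–(1.114)] for the reading `fam` and [B5, (1.126)–(1.127)]
for the reading `kfam` (both BY NAME, never discharged here), there are `δ > 0` and `A ≥ 0` —
chosen BEFORE the instance, i.e. free of `(n, M)`, of the bond and of `m` — such that for every
instance `i`, every cutoff radius `m` with `1 ≤ m ≤ n ≤ R m` whose `3m`-cube fits in one period
(`6m + 6 ≤ n M_μ`), and every pair of bonds,
`|𝒢((x,κ),(x₀,ν₀))| ≤ A η² e^{-(δ/n)‖v‖_∞} / max(1,‖v‖_∞)^{d-2}`, `v = liftZ (x − x₀)`, `η = 1/n`.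
At `d = 4` this is the `d0` row of `Beta/SquareTable` §13 for the torus-intrinsic separation
`‖v‖_∞ = tdist x₀ x`.  Instances with no admissible `m` (fewer than `6m + 6` fine sites in some
direction for every `m ≥ n/R`) are NOT covered here. [folklore] -/
theorem entry_bound (hd : 3 ≤ d) {R : ℝ} (hR : 1 ≤ R)
    (h12 : B5.Prop12Printed (fam nOf hn1 MOf a ha))
    (h126 : B5.Kernel126_127Printed (kfam nOf MOf)) :
    ∃ δ A : ℝ, 0 < δ ∧ 0 ≤ A ∧ ∀ (i : ι) (m : ℕ), 1 ≤ m → m ≤ nOf i →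
      ((nOf i : ℕ) : ℝ) ≤ R * m → (∀ μ, 6 * m + 6 ≤ fine (nOf i) (MOf i) μ) →
      ∀ (x x₀ : Tor (fine (nOf i) (MOf i))) (κ ν₀ : Fin d),
        ‖calG (nOf i) (hn1 i) (MOf i) a ha (x, κ) (x₀, ν₀)‖ ≤
          A * (1 / ((nOf i : ℕ) : ℝ)) ^ 2 *
            Real.exp (-(δ / ((nOf i : ℕ) : ℝ)) * (tdist x₀ x : ℝ)) /
              nrm (liftZ (x - x₀)) ^ (d - 2) := by
  obtain ⟨δ₀, C, hδ₀, hC, hloc⟩ := locBound_of_prop12 nOf hn1 MOf a ha h12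
  obtain ⟨δ₀', CK, hδ₀', hCK, hK⟩ := dPd_bound_of_kernel126 nOf MOf h126
  obtain ⟨Cρ, hCρ, hρ⟩ := resid_envelope (d := d) hd
  obtain ⟨CQ, hCQ, hQ⟩ := aQQ_envelope (d := d) hd ha.le
  obtain ⟨C₁, hC₁, hP⟩ := dPd_envelope (d := d) hd
  obtain ⟨C₀, hC₀, hpar⟩ := abs_paramT_le (d := d) hd
  obtain ⟨S, hS0, hS⟩ := sum_exp_tdist_le (d := d) (by omega) (half_pos hδ₀)
  -- the remainder rate `δ₁` and the final rate `δ₁ / 2`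
  have hδ₁pos : 0 < min (δ₀ / 2) δ₀' := lt_min (half_pos hδ₀) hδ₀'
  refine ⟨min (δ₀ / 2) δ₀' / 2, C₀ * Real.exp (3 * (min (δ₀ / 2) δ₀' / 2)) +
      C * S * Real.exp (min (δ₀ / 2) δ₀') *
        ((Cρ * Real.exp (δ₀' * 3) * R ^ d + (CK * C₁ * Real.exp (δ₀' * 4)
          + a * CQ * Real.exp (δ₀' * 5))) *
          (1 + (((d - 2 : ℕ) : ℝ) / (min (δ₀ / 2) δ₀' / 2)) ^ (d - 2))),
    half_pos hδ₁pos, by positivity, ?_⟩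
  intro i m hm hmn hRm hNm x x₀ κ ν₀
  have hnpos : (0 : ℝ) < ((nOf i : ℕ) : ℝ) := Nat.cast_pos.mpr (NeZero.pos _)
  have hn1' : (1 : ℝ) ≤ ((nOf i : ℕ) : ℝ) := by exact_mod_cast hn1 i
  have hmpos : (0 : ℝ) < (m : ℝ) := by exact_mod_cast hm
  have hmn' : (m : ℝ) ≤ ((nOf i : ℕ) : ℝ) := by exact_mod_cast hmn
  -- Step 1: the abstract entry bound
  have hdist : ∀ a b : Tor (MOf i), (0 : ℝ) ≤ (tdist a b : ℝ) := fun a b => Nat.cast_nonneg _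
  have htri : ∀ a b c : Tor (MOf i), (tdist a c : ℝ) ≤ (tdist a b : ℝ) + (tdist b c : ℝ) :=
    fun a b c => by exact_mod_cast tdist_triangle a b c
  have hc : ((nOf i : ℕ) : ℂ) ^ 2 ≠ 0 := pow_ne_zero 2 (Nat.cast_ne_zero.mpr (NeZero.ne _))
  have hVh : ∀ y' : Tor (MOf i),
      ‖restrictBlk (fun p : Tor (fine (nOf i) (MOf i)) × Fin d =>
          B5Blocks16.blockOf (nOf i) (MOf i) p.1)
          (Vop (nOf i) (MOf i) a *ᵥ colParam (nOf i) (MOf i) m x₀ ν₀) y'‖ ≤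
        (CK * (C₁ * (m : ℝ) ^ 2) / ((nOf i : ℕ) : ℝ) ^ d * Real.exp (δ₀' * 4)
          + a * (CQ * (m : ℝ) ^ 2) / ((nOf i : ℕ) : ℝ) ^ d * Real.exp (δ₀' * 5)) *
          Real.exp (-(δ₀' * (tdist y' (B5Blocks16.blockOf (nOf i) (MOf i) x₀) : ℝ))) := by
    intro y'
    rw [Vop_eq, Matrix.add_mulVec, Matrix.neg_mulVec, restrictBlk_add, restrictBlk_neg, add_mul]
    refine (norm_add_le _ _).trans (add_le_add ?_ ?_)
    · rw [norm_neg]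
      exact hP (nOf i) (MOf i) CK δ₀' hCK.le hδ₀'.le (hK i) m hm hmn x₀ ν₀ y'
    · exact hQ (nOf i) (MOf i) m hm hmn x₀ ν₀ δ₀' hδ₀'.le y'
  have main := norm_entry_le_of_parametrix (calG_mul_DeltaA (nOf i) (hn1 i) (MOf i) a ha)
    (DeltaA_eq_Lap_add_Vop (nOf i) (MOf i) a) (Lap_colParam (nOf i) (MOf i) hd hm hNm x₀ ν₀) hc
    (hloc i).1 hC.le hdist htri hδ₀.le hδ₀'.le (fun y => hS (MOf i) y) (by positivity)
    (by positivity) (fun y' => hρ (nOf i) (MOf i) m hm hmn x₀ ν₀ δ₀' hδ₀'.le y') hVh (x, κ)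
  have hnorm_c : ‖((nOf i : ℕ) : ℂ) ^ 2‖⁻¹ = (1 / ((nOf i : ℕ) : ℝ)) ^ 2 := by
    rw [norm_pow, Complex.norm_natCast, one_div, inv_pow]
  rw [hnorm_c] at main
  -- names: `N = n`, `r = ‖v‖_∞`, `nrm v = max 1 r`
  have hrsup : (tdist x₀ x : ℝ) = (supNorm (liftZ (x - x₀)) : ℝ) := rfl
  have hρ : nrm (liftZ (x - x₀)) = max 1 (tdist x₀ x : ℝ) := rfl
  have hr01 : (tdist x₀ x : ℝ) = 0 ∨ 1 ≤ (tdist x₀ x : ℝ) := by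
    rcases Nat.eq_zero_or_pos (tdist x₀ x) with h0 | hpos
    · left; exact_mod_cast h0
    · right; exact_mod_cast hpos
  -- Step 2: the singular part
  have sing : (1 / ((nOf i : ℕ) : ℝ)) ^ 2 * ‖colParam (nOf i) (MOf i) m x₀ ν₀ (x, κ)‖ ≤
      C₀ * Real.exp (3 * (min (δ₀ / 2) δ₀' / 2)) * (1 / ((nOf i : ℕ) : ℝ)) ^ 2 *
        Real.exp (-(min (δ₀ / 2) δ₀' / 2 / ((nOf i : ℕ) : ℝ)) * (tdist x₀ x : ℝ)) /
          nrm (liftZ (x - x₀)) ^ (d - 2) := by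
    have hρpos : 0 < nrm (liftZ (x - x₀)) := nrm_pos _
    by_cases hpx : paramT m x₀ x = 0
    · have : colParam (nOf i) (MOf i) m x₀ ν₀ (x, κ) = 0 := by
        rw [colParam, colOf_apply]; simp [hpx]
      rw [this, norm_zero, mul_zero]
      positivity
    · have h1 : ‖colParam (nOf i) (MOf i) m x₀ ν₀ (x, κ)‖ ≤ C₀ / nrm (liftZ (x - x₀)) ^ (d - 2) :=
        (norm_colOf_le (nOf i) (MOf i) _ ν₀ (x, κ)).trans (hpar (fine (nOf i) (MOf i)) m hm x₀ x)
      -- on the support `r ≤ 3m - 1 ≤ 3n`, so the exponential is `≥ e^{-3δ}`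
      have h2 : liftZ (x - x₀) ∈ cube (0 : (Fin d → ℤ)) (3 * m - 1) := by
        by_contra hmem; exact hpx (paramT_eq_zero_of_not_mem hm hmem)
      have h3 : (tdist x₀ x : ℝ) ≤ 3 * ((nOf i : ℕ) : ℝ) := by
        have := (mem_cube_zero_iff.mp h2).trans ((Nat.sub_le _ _).trans
          (Nat.mul_le_mul_left 3 hmn))
        rw [hrsup]; exact_mod_cast this
      have h4 : Real.exp (-(3 * (min (δ₀ / 2) δ₀' / 2))) ≤
          Real.exp (-(min (δ₀ / 2) δ₀' / 2 / ((nOf i : ℕ) : ℝ)) * (tdist x₀ x : ℝ)) := by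
        refine Real.exp_le_exp.mpr ?_
        have e1 : min (δ₀ / 2) δ₀' / 2 / ((nOf i : ℕ) : ℝ) * (tdist x₀ x : ℝ) ≤
            min (δ₀ / 2) δ₀' / 2 / ((nOf i : ℕ) : ℝ) * (3 * ((nOf i : ℕ) : ℝ)) :=
          mul_le_mul_of_nonneg_left h3 (by positivity)
        have e2 : min (δ₀ / 2) δ₀' / 2 / ((nOf i : ℕ) : ℝ) * (3 * ((nOf i : ℕ) : ℝ)) =
            3 * (min (δ₀ / 2) δ₀' / 2) := by field_simp
        rw [neg_mul]
        exact neg_le_neg (e1.trans_eq e2)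
      calc (1 / ((nOf i : ℕ) : ℝ)) ^ 2 * ‖colParam (nOf i) (MOf i) m x₀ ν₀ (x, κ)‖
          ≤ (1 / ((nOf i : ℕ) : ℝ)) ^ 2 * (C₀ / nrm (liftZ (x - x₀)) ^ (d - 2)) :=
            mul_le_mul_of_nonneg_left h1 (by positivity)
        _ = C₀ * (Real.exp (3 * (min (δ₀ / 2) δ₀' / 2)) * Real.exp (-(3 * (min (δ₀ / 2) δ₀' / 2))))
              * (1 / ((nOf i : ℕ) : ℝ)) ^ 2 / nrm (liftZ (x - x₀)) ^ (d - 2) := by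
            rw [← Real.exp_add, add_neg_cancel, Real.exp_zero]; ring
        _ ≤ C₀ * (Real.exp (3 * (min (δ₀ / 2) δ₀' / 2)) *
              Real.exp (-(min (δ₀ / 2) δ₀' / 2 / ((nOf i : ℕ) : ℝ)) * (tdist x₀ x : ℝ)))
              * (1 / ((nOf i : ℕ) : ℝ)) ^ 2 / nrm (liftZ (x - x₀)) ^ (d - 2) := by
            gcongr
        _ = _ := by ring
  -- Step 3: the remainder constants are `≤ B η^d`; block decay ⇒ fine decay
  have hKsum := remainder_consts_le d (δ₀' := δ₀') hnpos hmpos hmn' hRm hCρ hCK.le hC₁ hCQ ha.le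
  have hblk := exp_block_le_exp_fine (nOf i) (MOf i) hδ₁pos.le x x₀
  -- Step 4: the remainder in profile form
  have rem := remainder_profile hd (B := C * S * Real.exp (min (δ₀ / 2) δ₀') *
      (Cρ * Real.exp (δ₀' * 3) * R ^ d + (CK * C₁ * Real.exp (δ₀' * 4)
        + a * CQ * Real.exp (δ₀' * 5)))) hδ₁pos hn1' (by positivity) hr01
  rw [← hρ] at rem
  have rem0 : C * S * (Cρ / (m : ℝ) ^ d * Real.exp (δ₀' * 3) + (1 / ((nOf i : ℕ) : ℝ)) ^ 2 *
        (CK * (C₁ * (m : ℝ) ^ 2) / ((nOf i : ℕ) : ℝ) ^ d * Real.exp (δ₀' * 4)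
          + a * (CQ * (m : ℝ) ^ 2) / ((nOf i : ℕ) : ℝ) ^ d * Real.exp (δ₀' * 5))) *
      Real.exp (-(min (δ₀ / 2) δ₀' *
        (tdist (B5Blocks16.blockOf (nOf i) (MOf i) x) (B5Blocks16.blockOf (nOf i) (MOf i) x₀) : ℝ)))
      ≤ C * S * Real.exp (min (δ₀ / 2) δ₀') *
          (Cρ * Real.exp (δ₀' * 3) * R ^ d + (CK * C₁ * Real.exp (δ₀' * 4)
            + a * CQ * Real.exp (δ₀' * 5))) * (1 / ((nOf i : ℕ) : ℝ)) ^ d *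
          Real.exp (-(min (δ₀ / 2) δ₀' * (tdist x₀ x : ℝ) / ((nOf i : ℕ) : ℝ))) := by
    calc C * S * (Cρ / (m : ℝ) ^ d * Real.exp (δ₀' * 3) + (1 / ((nOf i : ℕ) : ℝ)) ^ 2 *
          (CK * (C₁ * (m : ℝ) ^ 2) / ((nOf i : ℕ) : ℝ) ^ d * Real.exp (δ₀' * 4)
            + a * (CQ * (m : ℝ) ^ 2) / ((nOf i : ℕ) : ℝ) ^ d * Real.exp (δ₀' * 5))) *
          Real.exp (-(min (δ₀ / 2) δ₀' *
            (tdist (B5Blocks16.blockOf (nOf i) (MOf i) x)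
              (B5Blocks16.blockOf (nOf i) (MOf i) x₀) : ℝ)))
        ≤ C * S * ((Cρ * Real.exp (δ₀' * 3) * R ^ d + (CK * C₁ * Real.exp (δ₀' * 4)
            + a * CQ * Real.exp (δ₀' * 5))) * (1 / ((nOf i : ℕ) : ℝ)) ^ d) *
            (Real.exp (min (δ₀ / 2) δ₀') *
              Real.exp (-(min (δ₀ / 2) δ₀' * (tdist x₀ x : ℝ) / ((nOf i : ℕ) : ℝ)))) :=
          mul_le_mul (mul_le_mul_of_nonneg_left hKsum (by positivity)) hblk (by positivity)
            (by positivity)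
      _ = _ := by ring
  -- Step 5: assemble
  refine (main.trans (add_le_add sing (rem0.trans rem))).trans (le_of_eq ?_)
  ring

end Assembly

/-! ## §5 The first-difference leg `d1` PER BASE POINT (difference in the observation variable) -/

section GradDictionary

variable {𝕜 : Type*} [RCLike 𝕜] {X : Type*} [Fintype X] {Y : Type*} [Fintype Y] [DecidableEq Y]

/-- **Abstract bound from an entry-type identity.** If a scalar `val` decomposes as
`val = (G' ρ)(x) + c⁻¹ (s − (G' w)(x))` with `G'` obeying a (1.110)-shape `LocBound` and `ρ`, `w`
blockwise exponentially enveloped about `y₀`, then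
`‖val‖ ≤ ‖c‖⁻¹‖s‖ + C S (Kρ + ‖c‖⁻¹ KV) e^{-min(δ₀/2,δ') dist(blk x, y₀)}` — the proof of
`VectorTails.norm_entry_le_of_parametrix` with the identity abstracted (used below with `G'` = a
shifted difference of `𝒢`). [folklore] -/
theorem norm_le_of_identity {G' : Matrix X X 𝕜} {c val s : 𝕜} {ρ w : X → 𝕜} {x : X}
    (hid : val = (G' *ᵥ ρ) x + c⁻¹ * (s - (G' *ᵥ w) x))
    {blk : X → Y} {dist : Y → Y → ℝ} {C δ₀ : ℝ} (hloc : LocBound G' blk dist C δ₀)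
    (hC : 0 ≤ C) (hdist : ∀ a b, 0 ≤ dist a b) (htri : ∀ a b c, dist a c ≤ dist a b + dist b c)
    (hδ₀ : 0 ≤ δ₀) {δ' S Kρ KV : ℝ} (hδ' : 0 ≤ δ')
    (hS : ∀ y, ∑ y', Real.exp (-(δ₀ / 2 * dist y y')) ≤ S) (hKρ : 0 ≤ Kρ) (hKV : 0 ≤ KV) {y₀ : Y}
    (hρ : ∀ y', ‖restrictBlk blk ρ y'‖ ≤ Kρ * Real.exp (-(δ' * dist y' y₀)))
    (hw : ∀ y', ‖restrictBlk blk w y'‖ ≤ KV * Real.exp (-(δ' * dist y' y₀))) :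
    ‖val‖ ≤ ‖c‖⁻¹ * ‖s‖ +
      C * S * (Kρ + ‖c‖⁻¹ * KV) * Real.exp (-(min (δ₀ / 2) δ' * dist (blk x) y₀)) := by
  rw [hid]
  have e1 := norm_mulVec_le_of_envelope hloc hC hdist htri hδ₀ hδ' hKρ hS hρ x
  have e2 := norm_mulVec_le_of_envelope hloc hC hdist htri hδ₀ hδ' hKV hS hw x
  set E := Real.exp (-(min (δ₀ / 2) δ' * dist (blk x) y₀)) with hE
  have e3 : ‖c⁻¹ * (s - (G' *ᵥ w) x)‖ ≤ ‖c‖⁻¹ * (‖s‖ + C * KV * S * E) := by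
    rw [norm_mul, norm_inv]
    refine mul_le_mul_of_nonneg_left ((norm_sub_le _ _).trans ?_) (inv_nonneg.mpr (norm_nonneg c))
    linarith only [e2]
  calc ‖(G' *ᵥ ρ) x + c⁻¹ * (s - (G' *ᵥ w) x)‖
      ≤ ‖(G' *ᵥ ρ) x‖ + ‖c⁻¹ * (s - (G' *ᵥ w) x)‖ := norm_add_le _ _
    _ ≤ C * Kρ * S * E + ‖c‖⁻¹ * (‖s‖ + C * KV * S * E) := add_le_add e1 e3
    _ = ‖c‖⁻¹ * ‖s‖ + C * S * (Kρ + ‖c‖⁻¹ * KV) * E := by ring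

end GradDictionary

section ShiftDiff

variable {d : ℕ} {N : Fin d → ℕ}

/-- the SHIFTED DIFFERENCE of a bond-indexed matrix in the observation variable:
`shiftDiff G μ (x, κ) q = G (x + e_μ, κ) q − G (x, κ) q`. [folklore] -/
def shiftDiff (G : Matrix (Tor N × Fin d) (Tor N × Fin d) ℂ) (μ : Fin d) :
    Matrix (Tor N × Fin d) (Tor N × Fin d) ℂ :=
  fun p q => G (p.1 + unitVec N μ, p.2) q - G p q

variable [hN : ∀ μ, NeZero (N μ)]

/-- `(shiftDiff G μ) J = (G J)(· + e_μ) − (G J)`. [folklore] -/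
theorem shiftDiff_mulVec (G : Matrix (Tor N × Fin d) (Tor N × Fin d) ℂ) (μ : Fin d)
    (J : Tor N × Fin d → ℂ) (p : Tor N × Fin d) :
    (shiftDiff G μ *ᵥ J) p = (G *ᵥ J) (p.1 + unitVec N μ, p.2) - (G *ᵥ J) p := by
  simp only [Matrix.mulVec, dotProduct, shiftDiff, sub_mul, Finset.sum_sub_distrib]

/-- **Entry identity for the shifted difference**: subtracting the Newton-parametrix entry
identities at `(x + e_μ, κ)` and `(x, κ)`,
`∂_μ G(p, x') = (∂_μG ρ)(p) + c⁻¹ ((h(p + e_μ) − h(p)) − (∂_μG (V h))(p))`. [folklore] -/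
theorem shiftDiff_entry_eq {G Δ Lc V : Matrix (Tor N × Fin d) (Tor N × Fin d) ℂ} {c : ℂ}
    (hG : G * Δ = 1) (hΔ : Δ = Lc + V) {x' : Tor N × Fin d} {h ρ : Tor N × Fin d → ℂ}
    (hpar : Lc *ᵥ h = c • (Pi.single x' 1 - ρ)) (hc : c ≠ 0) (μ : Fin d) (p : Tor N × Fin d) :
    shiftDiff G μ p x' = (shiftDiff G μ *ᵥ ρ) p +
      c⁻¹ * ((h (p.1 + unitVec N μ, p.2) - h p) - (shiftDiff G μ *ᵥ (V *ᵥ h)) p) := by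
  rw [shiftDiff_mulVec, shiftDiff_mulVec]
  simp only [shiftDiff]
  rw [entry_eq_of_parametrix hG hΔ hpar hc (p.1 + unitVec N μ, p.2),
    entry_eq_of_parametrix hG hΔ hpar hc p]
  ring

end ShiftDiff

section GradLoc

variable {d : ℕ} (n : ℕ) [NeZero n] (M : Fin d → ℕ) [hM : ∀ μ, NeZero (M μ)] (hn : 1 ≤ n)
  (a : ℝ) (ha : 0 < a)

/-- **`GradBound` is a (1.110)-shape `LocBound` for the shifted differences of `𝒢` with constant
`C/n`** (the forward difference `fdiff` carries the factor `n = η⁻¹`). [folklore] -/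
theorem locBound_shiftDiff {C δ₀ : ℝ} (h : GradBound n M hn a ha C δ₀) (μ : Fin d) :
    LocBound (shiftDiff (calG n hn M a ha) μ)
      (fun p : Tor (fine n M) × Fin d => B5Blocks16.blockOf n M p.1)
      (fun y y' => (tdist y y' : ℝ)) (C / n) δ₀ := by
  intro J y' hJ p
  rw [shiftDiff_mulVec]
  have hnpos : (0 : ℝ) < n := Nat.cast_pos.mpr (NeZero.pos n)
  have h1 := h J y' hJ p μ
  have e : ‖fdiff n M (calG n hn M a ha *ᵥ J) μ p‖ = (n : ℝ) *
      ‖(calG n hn M a ha *ᵥ J) (p.1 + unitVec (fine n M) μ, p.2) - (calG n hn M a ha *ᵥ J) p‖ := by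
    simp only [fdiff, norm_mul, Complex.norm_natCast]
  rw [e] at h1
  calc ‖(calG n hn M a ha *ᵥ J) (p.1 + unitVec (fine n M) μ, p.2) - (calG n hn M a ha *ᵥ J) p‖
      = (n : ℝ) * ‖(calG n hn M a ha *ᵥ J) (p.1 + unitVec (fine n M) μ, p.2)
          - (calG n hn M a ha *ᵥ J) p‖ / n := by field_simp
    _ ≤ C * Real.exp (-(δ₀ * (tdist (B5Blocks16.blockOf n M p.1) y' : ℝ))) * ‖J‖ / n :=
        div_le_div_of_nonneg_right h1 hnpos.le
    _ = C / n * Real.exp (-(δ₀ * (tdist (B5Blocks16.blockOf n M p.1) y' : ℝ))) * ‖J‖ := by ring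

end GradLoc

section GradAssembly

open Literature.MathematicalPhysics.QuantumFieldTheory.Balaban1983to89.Beta.PoissonInterior

variable {d : ℕ} {ι : Type} (nOf : ι → ℕ) [hn0 : ∀ i, NeZero (nOf i)] (hn1 : ∀ i, 1 ≤ nOf i)
  (MOf : ι → Fin d → ℕ) [hM0 : ∀ i μ, NeZero (MOf i μ)] (a : ℝ) (ha : 0 < a)

/-- **THE FIRST-DIFFERENCE LEG OF THE COVARIANT PROPAGATOR, PER BASE POINT (d1 shape).**  Same
hypotheses and the same uniformity as `entry_bound`; the difference is taken in the OBSERVATION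
variable `x ↦ x + e_μ` at fixed base bond `(x₀, ν₀)`:
`|𝒢((x+e_μ,κ),(x₀,ν₀)) − 𝒢((x,κ),(x₀,ν₀))| ≤ A η² e^{-(δ/n)‖v‖_∞} / max(1,‖v‖_∞)^{d-1}` — one
power of `max(1,‖v‖_∞)` better than `d0`, as a lattice gradient should be.  Inputs beyond those
of `entry_bound`: the gradient clause of (1.110) (`GradBound`, read BY NAME through
`Prop12Printed`) and `VectorTails.abs_paramT_diff_le`.  At `d = 4` this is the `d1` row of
`Beta/SquareTable` §13 per base point. [folklore] -/
theorem entry_diff_bound (hd : 3 ≤ d) {R : ℝ} (hR : 1 ≤ R)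
    (h12 : B5.Prop12Printed (fam nOf hn1 MOf a ha))
    (h126 : B5.Kernel126_127Printed (kfam nOf MOf)) :
    ∃ δ A : ℝ, 0 < δ ∧ 0 ≤ A ∧ ∀ (i : ι) (m : ℕ), 1 ≤ m → m ≤ nOf i →
      ((nOf i : ℕ) : ℝ) ≤ R * m → (∀ μ, 6 * m + 6 ≤ fine (nOf i) (MOf i) μ) →
      ∀ (x x₀ : Tor (fine (nOf i) (MOf i))) (κ ν₀ μ : Fin d),
        ‖calG (nOf i) (hn1 i) (MOf i) a ha (x + unitVec (fine (nOf i) (MOf i)) μ, κ) (x₀, ν₀)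
            - calG (nOf i) (hn1 i) (MOf i) a ha (x, κ) (x₀, ν₀)‖ ≤
          A * (1 / ((nOf i : ℕ) : ℝ)) ^ 2 *
            Real.exp (-(δ / ((nOf i : ℕ) : ℝ)) * (tdist x₀ x : ℝ)) /
              nrm (liftZ (x - x₀)) ^ (d - 1) := by
  obtain ⟨δ₀, C, hδ₀, hC, hloc⟩ := locBound_of_prop12 nOf hn1 MOf a ha h12
  obtain ⟨δ₀', CK, hδ₀', hCK, hK⟩ := dPd_bound_of_kernel126 nOf MOf h126
  obtain ⟨Cρ, hCρ, hρ⟩ := resid_envelope (d := d) hd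
  obtain ⟨CQ, hCQ, hQ⟩ := aQQ_envelope (d := d) hd ha.le
  obtain ⟨C₁, hC₁, hP⟩ := dPd_envelope (d := d) hd
  obtain ⟨C₀, hC₀, hpar⟩ := abs_paramT_diff_le (d := d) hd
  obtain ⟨S, hS0, hS⟩ := sum_exp_tdist_le (d := d) (by omega) (half_pos hδ₀)
  have hδ₁pos : 0 < min (δ₀ / 2) δ₀' := lt_min (half_pos hδ₀) hδ₀'
  refine ⟨min (δ₀ / 2) δ₀' / 2, C₀ * Real.exp (4 * (min (δ₀ / 2) δ₀' / 2)) +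
      C * S * Real.exp (min (δ₀ / 2) δ₀') *
        ((Cρ * Real.exp (δ₀' * 3) * R ^ d + (CK * C₁ * Real.exp (δ₀' * 4)
          + a * CQ * Real.exp (δ₀' * 5))) *
          (1 + (((d + 1 - 2 : ℕ) : ℝ) / (min (δ₀ / 2) δ₀' / 2)) ^ (d + 1 - 2))),
    half_pos hδ₁pos, by positivity, ?_⟩
  intro i m hm hmn hRm hNm x x₀ κ ν₀ μ
  have hnpos : (0 : ℝ) < ((nOf i : ℕ) : ℝ) := Nat.cast_pos.mpr (NeZero.pos _)
  have hn1' : (1 : ℝ) ≤ ((nOf i : ℕ) : ℝ) := by exact_mod_cast hn1 i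
  have hmpos : (0 : ℝ) < (m : ℝ) := by exact_mod_cast hm
  have hmn' : (m : ℝ) ≤ ((nOf i : ℕ) : ℝ) := by exact_mod_cast hmn
  -- Step 1: the abstract bound for the shifted difference
  have hdist : ∀ a b : Tor (MOf i), (0 : ℝ) ≤ (tdist a b : ℝ) := fun a b => Nat.cast_nonneg _
  have htri : ∀ a b c : Tor (MOf i), (tdist a c : ℝ) ≤ (tdist a b : ℝ) + (tdist b c : ℝ) :=
    fun a b c => by exact_mod_cast tdist_triangle a b c
  have hc : ((nOf i : ℕ) : ℂ) ^ 2 ≠ 0 := pow_ne_zero 2 (Nat.cast_ne_zero.mpr (NeZero.ne _))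
  have hVh : ∀ y' : Tor (MOf i),
      ‖restrictBlk (fun p : Tor (fine (nOf i) (MOf i)) × Fin d =>
          B5Blocks16.blockOf (nOf i) (MOf i) p.1)
          (Vop (nOf i) (MOf i) a *ᵥ colParam (nOf i) (MOf i) m x₀ ν₀) y'‖ ≤
        (CK * (C₁ * (m : ℝ) ^ 2) / ((nOf i : ℕ) : ℝ) ^ d * Real.exp (δ₀' * 4)
          + a * (CQ * (m : ℝ) ^ 2) / ((nOf i : ℕ) : ℝ) ^ d * Real.exp (δ₀' * 5)) *
          Real.exp (-(δ₀' * (tdist y' (B5Blocks16.blockOf (nOf i) (MOf i) x₀) : ℝ))) := by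
    intro y'
    rw [Vop_eq, Matrix.add_mulVec, Matrix.neg_mulVec, restrictBlk_add, restrictBlk_neg, add_mul]
    refine (norm_add_le _ _).trans (add_le_add ?_ ?_)
    · rw [norm_neg]
      exact hP (nOf i) (MOf i) CK δ₀' hCK.le hδ₀'.le (hK i) m hm hmn x₀ ν₀ y'
    · exact hQ (nOf i) (MOf i) m hm hmn x₀ ν₀ δ₀' hδ₀'.le y'
  have hid := shiftDiff_entry_eq (calG_mul_DeltaA (nOf i) (hn1 i) (MOf i) a ha)
    (DeltaA_eq_Lap_add_Vop (nOf i) (MOf i) a) (Lap_colParam (nOf i) (MOf i) hd hm hNm x₀ ν₀) hc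
    μ (x, κ)
  have main := norm_le_of_identity hid
    (locBound_shiftDiff (nOf i) (MOf i) (hn1 i) a ha (hloc i).2 μ)
    (div_nonneg hC.le hnpos.le) hdist htri hδ₀.le hδ₀'.le (fun y => hS (MOf i) y)
    (by positivity) (by positivity)
    (fun y' => hρ (nOf i) (MOf i) m hm hmn x₀ ν₀ δ₀' hδ₀'.le y') hVh
  have hnorm_c : ‖((nOf i : ℕ) : ℂ) ^ 2‖⁻¹ = (1 / ((nOf i : ℕ) : ℝ)) ^ 2 := by
    rw [norm_pow, Complex.norm_natCast, one_div, inv_pow]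
  rw [hnorm_c] at main
  have hlhs : shiftDiff (calG (nOf i) (hn1 i) (MOf i) a ha) μ (x, κ) (x₀, ν₀) =
      calG (nOf i) (hn1 i) (MOf i) a ha (x + unitVec (fine (nOf i) (MOf i)) μ, κ) (x₀, ν₀)
        - calG (nOf i) (hn1 i) (MOf i) a ha (x, κ) (x₀, ν₀) := rfl
  rw [hlhs] at main
  -- names
  have hrsup : (tdist x₀ x : ℝ) = (supNorm (liftZ (x - x₀)) : ℝ) := rfl
  have hρ : nrm (liftZ (x - x₀)) = max 1 (tdist x₀ x : ℝ) := rfl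
  have hr01 : (tdist x₀ x : ℝ) = 0 ∨ 1 ≤ (tdist x₀ x : ℝ) := by
    rcases Nat.eq_zero_or_pos (tdist x₀ x) with h0 | hpos
    · left; exact_mod_cast h0
    · right; exact_mod_cast hpos
  -- Step 2: the singular part (the parametrix difference)
  have sing : (1 / ((nOf i : ℕ) : ℝ)) ^ 2 *
      ‖colParam (nOf i) (MOf i) m x₀ ν₀ ((x, κ).1 + unitVec (fine (nOf i) (MOf i)) μ, (x, κ).2)
        - colParam (nOf i) (MOf i) m x₀ ν₀ (x, κ)‖ ≤
      C₀ * Real.exp (4 * (min (δ₀ / 2) δ₀' / 2)) * (1 / ((nOf i : ℕ) : ℝ)) ^ 2 *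
        Real.exp (-(min (δ₀ / 2) δ₀' / 2 / ((nOf i : ℕ) : ℝ)) * (tdist x₀ x : ℝ)) /
          nrm (liftZ (x - x₀)) ^ (d - 1) := by
    have hρpos : 0 < nrm (liftZ (x - x₀)) := nrm_pos _
    by_cases hmem : liftZ (x - x₀) ∈ cube (0 : (Fin d → ℤ)) (3 * m + 1)
    · have h1 : ‖colParam (nOf i) (MOf i) m x₀ ν₀ (x + unitVec (fine (nOf i) (MOf i)) μ, κ)
          - colParam (nOf i) (MOf i) m x₀ ν₀ (x, κ)‖ ≤ C₀ / nrm (liftZ (x - x₀)) ^ (d - 1) :=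
        (norm_colOf_sub_le (nOf i) (MOf i) _ ν₀ x _ κ).trans
          (hpar (fine (nOf i) (MOf i)) m hm hNm x₀ x μ hmem)
      have h3 : (tdist x₀ x : ℝ) ≤ 4 * ((nOf i : ℕ) : ℝ) := by
        have := mem_cube_zero_iff.mp hmem
        have h' : ((supNorm (liftZ (x - x₀)) : ℕ) : ℝ) ≤ 3 * (m : ℝ) + 1 := by exact_mod_cast this
        rw [hrsup]; linarith only [h', hmn', hn1']
      have h4 : Real.exp (-(4 * (min (δ₀ / 2) δ₀' / 2))) ≤
          Real.exp (-(min (δ₀ / 2) δ₀' / 2 / ((nOf i : ℕ) : ℝ)) * (tdist x₀ x : ℝ)) := by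
        refine Real.exp_le_exp.mpr ?_
        have e1 : min (δ₀ / 2) δ₀' / 2 / ((nOf i : ℕ) : ℝ) * (tdist x₀ x : ℝ) ≤
            min (δ₀ / 2) δ₀' / 2 / ((nOf i : ℕ) : ℝ) * (4 * ((nOf i : ℕ) : ℝ)) :=
          mul_le_mul_of_nonneg_left h3 (by positivity)
        have e2 : min (δ₀ / 2) δ₀' / 2 / ((nOf i : ℕ) : ℝ) * (4 * ((nOf i : ℕ) : ℝ)) =
            4 * (min (δ₀ / 2) δ₀' / 2) := by field_simp
        rw [neg_mul]
        exact neg_le_neg (e1.trans_eq e2)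
      calc (1 / ((nOf i : ℕ) : ℝ)) ^ 2 *
            ‖colParam (nOf i) (MOf i) m x₀ ν₀ (x + unitVec (fine (nOf i) (MOf i)) μ, κ)
              - colParam (nOf i) (MOf i) m x₀ ν₀ (x, κ)‖
          ≤ (1 / ((nOf i : ℕ) : ℝ)) ^ 2 * (C₀ / nrm (liftZ (x - x₀)) ^ (d - 1)) :=
            mul_le_mul_of_nonneg_left h1 (by positivity)
        _ = C₀ * (Real.exp (4 * (min (δ₀ / 2) δ₀' / 2)) *
              Real.exp (-(4 * (min (δ₀ / 2) δ₀' / 2))))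
              * (1 / ((nOf i : ℕ) : ℝ)) ^ 2 / nrm (liftZ (x - x₀)) ^ (d - 1) := by
            rw [← Real.exp_add, add_neg_cancel, Real.exp_zero]; ring
        _ ≤ C₀ * (Real.exp (4 * (min (δ₀ / 2) δ₀' / 2)) *
              Real.exp (-(min (δ₀ / 2) δ₀' / 2 / ((nOf i : ℕ) : ℝ)) * (tdist x₀ x : ℝ)))
              * (1 / ((nOf i : ℕ) : ℝ)) ^ 2 / nrm (liftZ (x - x₀)) ^ (d - 1) := by
            gcongr
        _ = _ := by ring
    · -- off the `(3m+1)`-cube both parametrix values vanish (torus transport of the unit step)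
      have h0 : paramT m x₀ x = 0 :=
        paramT_eq_zero_of_not_mem hm (fun h' => hmem (cube_mono (by omega) h'))
      have h0' : paramT m x₀ (x + unitVec (fine (nOf i) (MOf i)) μ) = 0 := by
        refine paramT_eq_zero_of_not_mem hm ?_
        have e1 : x + unitVec (fine (nOf i) (MOf i)) μ - x₀ =
            (x - x₀) + castT (fine (nOf i) (MOf i)) (Pi.single μ 1) := by
          rw [castT_single]; show x + Pi.single μ 1 - x₀ = x - x₀ + Pi.single μ 1; abel
        rw [e1]
        have hmem' : liftZ (x - x₀) ∉ cube (0 : (Fin d → ℤ)) (3 * m - 1 + 2) := by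
          rwa [show 3 * m - 1 + 2 = 3 * m + 1 by omega]
        exact liftZ_add_castT_not_mem hmem'
          (fun μ' => by have := hNm μ'; rw [fine] at this ⊢; omega) (supNorm_single_one μ)
      have : colParam (nOf i) (MOf i) m x₀ ν₀ (x + unitVec (fine (nOf i) (MOf i)) μ, κ)
          - colParam (nOf i) (MOf i) m x₀ ν₀ (x, κ) = 0 := by
        simp only [colParam, colOf_apply, h0, h0']
        split_ifs <;> simp
      rw [this, norm_zero, mul_zero]
      positivity
  -- Step 3: constants and block ⇒ fine decay
  have hKsum := remainder_consts_le d (δ₀' := δ₀') hnpos hmpos hmn' hRm hCρ hCK.le hC₁ hCQ ha.le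
  have hblk := exp_block_le_exp_fine (nOf i) (MOf i) hδ₁pos.le x x₀
  -- Step 4: the remainder in profile form, one power of `η` better
  have rem := remainder_profile (d := d + 1) (by omega) (B := C * S * Real.exp (min (δ₀ / 2) δ₀') *
      (Cρ * Real.exp (δ₀' * 3) * R ^ d + (CK * C₁ * Real.exp (δ₀' * 4)
        + a * CQ * Real.exp (δ₀' * 5)))) hδ₁pos hn1' (by positivity) hr01
  rw [← hρ, show d + 1 - 2 = d - 1 by omega] at rem
  have rem0 : C / ((nOf i : ℕ) : ℝ) * S * (Cρ / (m : ℝ) ^ d * Real.exp (δ₀' * 3) +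
        (1 / ((nOf i : ℕ) : ℝ)) ^ 2 *
        (CK * (C₁ * (m : ℝ) ^ 2) / ((nOf i : ℕ) : ℝ) ^ d * Real.exp (δ₀' * 4)
          + a * (CQ * (m : ℝ) ^ 2) / ((nOf i : ℕ) : ℝ) ^ d * Real.exp (δ₀' * 5))) *
      Real.exp (-(min (δ₀ / 2) δ₀' *
        (tdist (B5Blocks16.blockOf (nOf i) (MOf i) x) (B5Blocks16.blockOf (nOf i) (MOf i) x₀) : ℝ)))
      ≤ C * S * Real.exp (min (δ₀ / 2) δ₀') *
          (Cρ * Real.exp (δ₀' * 3) * R ^ d + (CK * C₁ * Real.exp (δ₀' * 4)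
            + a * CQ * Real.exp (δ₀' * 5))) * (1 / ((nOf i : ℕ) : ℝ)) ^ (d + 1) *
          Real.exp (-(min (δ₀ / 2) δ₀' * (tdist x₀ x : ℝ) / ((nOf i : ℕ) : ℝ))) := by
    calc C / ((nOf i : ℕ) : ℝ) * S * (Cρ / (m : ℝ) ^ d * Real.exp (δ₀' * 3) +
          (1 / ((nOf i : ℕ) : ℝ)) ^ 2 *
          (CK * (C₁ * (m : ℝ) ^ 2) / ((nOf i : ℕ) : ℝ) ^ d * Real.exp (δ₀' * 4)
            + a * (CQ * (m : ℝ) ^ 2) / ((nOf i : ℕ) : ℝ) ^ d * Real.exp (δ₀' * 5))) *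
          Real.exp (-(min (δ₀ / 2) δ₀' *
            (tdist (B5Blocks16.blockOf (nOf i) (MOf i) x)
              (B5Blocks16.blockOf (nOf i) (MOf i) x₀) : ℝ)))
        ≤ C / ((nOf i : ℕ) : ℝ) * S * ((Cρ * Real.exp (δ₀' * 3) * R ^ d
            + (CK * C₁ * Real.exp (δ₀' * 4) + a * CQ * Real.exp (δ₀' * 5))) *
              (1 / ((nOf i : ℕ) : ℝ)) ^ d) *
            (Real.exp (min (δ₀ / 2) δ₀') *
              Real.exp (-(min (δ₀ / 2) δ₀' * (tdist x₀ x : ℝ) / ((nOf i : ℕ) : ℝ)))) :=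
          mul_le_mul (mul_le_mul_of_nonneg_left hKsum (by positivity)) hblk (by positivity)
            (by positivity)
      _ = _ := by rw [pow_succ]; ring
  -- Step 5: assemble
  refine (main.trans (add_le_add sing (rem0.trans rem))).trans (le_of_eq ?_)
  rw [show d + 1 - 2 = d - 1 by omega]
  ring

end GradAssembly

/-! ## §6 The two legs with ONE rate (consumer packaging) -/

section Legs

open Literature.MathematicalPhysics.QuantumFieldTheory.Balaban1983to89.Beta.PoissonInterior

variable {d : ℕ} {ι : Type} (nOf : ι → ℕ) [hn0 : ∀ i, NeZero (nOf i)] (hn1 : ∀ i, 1 ≤ nOf i)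
  (MOf : ι → Fin d → ℕ) [hM0 : ∀ i μ, NeZero (MOf i μ)] (a : ℝ) (ha : 0 < a)

/-- **`d0` and `d1` per base point with a common rate `δ`** (`entry_bound` ∧ `entry_diff_bound`,
rates merged by monotonicity of `exp`).  HYPOTHESES, verbatim: `d ≥ 3`, `R ≥ 1`,
`B5.Prop12Printed (fam …)` [B5, (1.110)–(1.114)] and `B5.Kernel126_127Printed (kfam …)`
[B5, (1.126)–(1.127)] BY NAME; per instance `1 ≤ m ≤ n ≤ R m`, `6m + 6 ≤ n M_μ`. [folklore] -/
theorem value_and_difference_legs (hd : 3 ≤ d) {R : ℝ} (hR : 1 ≤ R)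
    (h12 : B5.Prop12Printed (fam nOf hn1 MOf a ha))
    (h126 : B5.Kernel126_127Printed (kfam nOf MOf)) :
    ∃ δ A₀ A₁ : ℝ, 0 < δ ∧ 0 ≤ A₀ ∧ 0 ≤ A₁ ∧ ∀ (i : ι) (m : ℕ), 1 ≤ m → m ≤ nOf i →
      ((nOf i : ℕ) : ℝ) ≤ R * m → (∀ μ, 6 * m + 6 ≤ fine (nOf i) (MOf i) μ) →
      ∀ (x x₀ : Tor (fine (nOf i) (MOf i))) (κ ν₀ : Fin d),
        ‖calG (nOf i) (hn1 i) (MOf i) a ha (x, κ) (x₀, ν₀)‖ ≤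
            A₀ * (1 / ((nOf i : ℕ) : ℝ)) ^ 2 *
              Real.exp (-(δ / ((nOf i : ℕ) : ℝ)) * (tdist x₀ x : ℝ)) /
                nrm (liftZ (x - x₀)) ^ (d - 2) ∧
        ∀ μ : Fin d,
          ‖calG (nOf i) (hn1 i) (MOf i) a ha (x + unitVec (fine (nOf i) (MOf i)) μ, κ) (x₀, ν₀)
              - calG (nOf i) (hn1 i) (MOf i) a ha (x, κ) (x₀, ν₀)‖ ≤
            A₁ * (1 / ((nOf i : ℕ) : ℝ)) ^ 2 *
              Real.exp (-(δ / ((nOf i : ℕ) : ℝ)) * (tdist x₀ x : ℝ)) /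
                nrm (liftZ (x - x₀)) ^ (d - 1) := by
  obtain ⟨δa, A₀, hδa, hA₀, h0⟩ := entry_bound nOf hn1 MOf a ha hd hR h12 h126
  obtain ⟨δb, A₁, hδb, hA₁, h1⟩ := entry_diff_bound nOf hn1 MOf a ha hd hR h12 h126
  refine ⟨min δa δb, A₀, A₁, lt_min hδa hδb, hA₀, hA₁, fun i m hm hmn hRm hNm x x₀ κ ν₀ => ?_⟩
  have hnpos : (0 : ℝ) < ((nOf i : ℕ) : ℝ) := Nat.cast_pos.mpr (NeZero.pos _)
  have hr0 : (0 : ℝ) ≤ (tdist x₀ x : ℝ) := Nat.cast_nonneg _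
  have hρpos : 0 < nrm (liftZ (x - x₀)) := nrm_pos _
  have mono : ∀ {δ' : ℝ}, min δa δb ≤ δ' →
      Real.exp (-(δ' / ((nOf i : ℕ) : ℝ)) * (tdist x₀ x : ℝ)) ≤
        Real.exp (-(min δa δb / ((nOf i : ℕ) : ℝ)) * (tdist x₀ x : ℝ)) := by
    intro δ' hle
    refine Real.exp_le_exp.mpr ?_
    rw [neg_mul, neg_mul]
    exact neg_le_neg (mul_le_mul_of_nonneg_right (div_le_div_of_nonneg_right hle hnpos.le) hr0)
  refine ⟨(h0 i m hm hmn hRm hNm x x₀ κ ν₀).trans ?_,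
    fun μ => (h1 i m hm hmn hRm hNm x x₀ κ ν₀ μ).trans ?_⟩
  · exact div_le_div_of_nonneg_right (mul_le_mul_of_nonneg_left (mono (min_le_left _ _))
      (by positivity)) (by positivity)
  · exact div_le_div_of_nonneg_right (mul_le_mul_of_nonneg_left (mono (min_le_right _ _))
      (by positivity)) (by positivity)

end Legs

/-! ## §7 Bounded `n`, and the legs UNIFORM IN THE INSTANCE (no cutoff-radius side conditions) -/

section Small

open Literature.MathematicalPhysics.QuantumFieldTheory.Balaban1983to89.Beta.PoissonInterior

variable {d : ℕ} {ι : Type} (nOf : ι → ℕ) [hn0 : ∀ i, NeZero (nOf i)] (hn1 : ∀ i, 1 ≤ nOf i)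
  (MOf : ι → Fin d → ℕ) [hM0 : ∀ i μ, NeZero (MOf i μ)] (a : ℝ) (ha : 0 < a)

/-- a point source at the bond `(x₀, ν₀)` is supported in the block of `x₀`. [folklore] -/
theorem single_supported (n : ℕ) [NeZero n] (M : Fin d → ℕ) [∀ μ, NeZero (M μ)]
    (x₀ : Tor (fine n M)) (ν₀ : Fin d) :
    ∀ z : Tor (fine n M) × Fin d, B5Blocks16.blockOf n M z.1 ≠ B5Blocks16.blockOf n M x₀ →
      (Pi.single (x₀, ν₀) (1 : ℂ) : Tor (fine n M) × Fin d → ℂ) z = 0 := by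
  intro z hz
  have hne : z ≠ (x₀, ν₀) := fun h => hz (by rw [h])
  simp [hne]

/-- **`d0` for BOUNDED `n ≤ N₀` from (1.110) alone** (the `η^{-d}` loss of the point-source reading
is then a constant `≤ N₀^d`). [folklore] -/
theorem entry_bound_small (hd : 3 ≤ d) (N₀ : ℕ)
    (h12 : B5.Prop12Printed (fam nOf hn1 MOf a ha)) :
    ∃ δ A : ℝ, 0 < δ ∧ 0 ≤ A ∧ ∀ (i : ι), nOf i ≤ N₀ →
      ∀ (x x₀ : Tor (fine (nOf i) (MOf i))) (κ ν₀ : Fin d),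
        ‖calG (nOf i) (hn1 i) (MOf i) a ha (x, κ) (x₀, ν₀)‖ ≤
          A * (1 / ((nOf i : ℕ) : ℝ)) ^ 2 *
            Real.exp (-(δ / ((nOf i : ℕ) : ℝ)) * (tdist x₀ x : ℝ)) /
              nrm (liftZ (x - x₀)) ^ (d - 2) := by
  obtain ⟨δ₀, C, hδ₀, hC, hloc⟩ := locBound_of_prop12 nOf hn1 MOf a ha h12
  refine ⟨δ₀ / 2, C * Real.exp δ₀ * (N₀ : ℝ) ^ d * (1 + (((d - 2 : ℕ) : ℝ) / (δ₀ / 2)) ^ (d - 2)),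
    half_pos hδ₀, by positivity, fun i hN x x₀ κ ν₀ => ?_⟩
  have hnpos : (0 : ℝ) < ((nOf i : ℕ) : ℝ) := Nat.cast_pos.mpr (NeZero.pos _)
  have hn1' : (1 : ℝ) ≤ ((nOf i : ℕ) : ℝ) := by exact_mod_cast hn1 i
  have hN' : ((nOf i : ℕ) : ℝ) ≤ (N₀ : ℝ) := by exact_mod_cast hN
  have hρ : nrm (liftZ (x - x₀)) = max 1 (tdist x₀ x : ℝ) := rfl
  have hr01 : (tdist x₀ x : ℝ) = 0 ∨ 1 ≤ (tdist x₀ x : ℝ) := by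
    rcases Nat.eq_zero_or_pos (tdist x₀ x) with h0 | hpos
    · left; exact_mod_cast h0
    · right; exact_mod_cast hpos
  -- (1.110) on the point source
  have h1 : ‖calG (nOf i) (hn1 i) (MOf i) a ha (x, κ) (x₀, ν₀)‖ ≤
      C * Real.exp (-(δ₀ * (tdist (B5Blocks16.blockOf (nOf i) (MOf i) x)
        (B5Blocks16.blockOf (nOf i) (MOf i) x₀) : ℝ))) := by
    have := (hloc i).1 (Pi.single (x₀, ν₀) 1) (B5Blocks16.blockOf (nOf i) (MOf i) x₀)
      (single_supported (nOf i) (MOf i) x₀ ν₀) (x, κ)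
    rw [Matrix.mulVec_single_one, Pi.norm_single, norm_one, mul_one] at this
    exact this
  have h2 := exp_block_le_exp_fine (nOf i) (MOf i) hδ₀.le x x₀
  have rem := remainder_profile hd (B := (1 : ℝ)) hδ₀ hn1' zero_le_one hr01
  rw [← hρ, one_mul, one_mul] at rem
  -- `e^{-δ₀ r/n} = n^d · (η^d e^{-δ₀ r/n}) ≤ N₀^d · profile`
  have hnd : Real.exp (-(δ₀ * (tdist x₀ x : ℝ) / ((nOf i : ℕ) : ℝ))) =
      ((nOf i : ℕ) : ℝ) ^ d * ((1 / ((nOf i : ℕ) : ℝ)) ^ d *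
        Real.exp (-(δ₀ * (tdist x₀ x : ℝ) / ((nOf i : ℕ) : ℝ)))) := by
    rw [← mul_assoc, ← mul_pow, mul_one_div_cancel hnpos.ne', one_pow, one_mul]
  have hNd : ((nOf i : ℕ) : ℝ) ^ d ≤ (N₀ : ℝ) ^ d := pow_le_pow_left₀ hnpos.le hN' d
  calc ‖calG (nOf i) (hn1 i) (MOf i) a ha (x, κ) (x₀, ν₀)‖
      ≤ C * (Real.exp δ₀ * Real.exp (-(δ₀ * (tdist x₀ x : ℝ) / ((nOf i : ℕ) : ℝ)))) :=
        h1.trans (mul_le_mul_of_nonneg_left h2 hC.le)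
    _ = C * Real.exp δ₀ * (((nOf i : ℕ) : ℝ) ^ d * ((1 / ((nOf i : ℕ) : ℝ)) ^ d *
          Real.exp (-(δ₀ * (tdist x₀ x : ℝ) / ((nOf i : ℕ) : ℝ))))) := by
        rw [← hnd]; ring
    _ ≤ C * Real.exp δ₀ * ((N₀ : ℝ) ^ d * ((1 + (((d - 2 : ℕ) : ℝ) / (δ₀ / 2)) ^ (d - 2)) *
          (1 / ((nOf i : ℕ) : ℝ)) ^ 2 * Real.exp (-(δ₀ / 2 / ((nOf i : ℕ) : ℝ)) * (tdist x₀ x : ℝ))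
            / nrm (liftZ (x - x₀)) ^ (d - 2))) := by
        refine mul_le_mul_of_nonneg_left (mul_le_mul hNd rem (by positivity) (by positivity))
          (by positivity)
    _ = _ := by ring

/-- **`d1` for BOUNDED `n ≤ N₀` from the gradient clause of (1.110) alone.** [folklore] -/
theorem entry_diff_bound_small (hd : 3 ≤ d) (N₀ : ℕ)
    (h12 : B5.Prop12Printed (fam nOf hn1 MOf a ha)) :
    ∃ δ A : ℝ, 0 < δ ∧ 0 ≤ A ∧ ∀ (i : ι), nOf i ≤ N₀ →
      ∀ (x x₀ : Tor (fine (nOf i) (MOf i))) (κ ν₀ μ : Fin d),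
        ‖calG (nOf i) (hn1 i) (MOf i) a ha (x + unitVec (fine (nOf i) (MOf i)) μ, κ) (x₀, ν₀)
            - calG (nOf i) (hn1 i) (MOf i) a ha (x, κ) (x₀, ν₀)‖ ≤
          A * (1 / ((nOf i : ℕ) : ℝ)) ^ 2 *
            Real.exp (-(δ / ((nOf i : ℕ) : ℝ)) * (tdist x₀ x : ℝ)) /
              nrm (liftZ (x - x₀)) ^ (d - 1) := by
  obtain ⟨δ₀, C, hδ₀, hC, hloc⟩ := locBound_of_prop12 nOf hn1 MOf a ha h12
  refine ⟨δ₀ / 2, C * Real.exp δ₀ * (N₀ : ℝ) ^ d *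
      (1 + (((d + 1 - 2 : ℕ) : ℝ) / (δ₀ / 2)) ^ (d + 1 - 2)),
    half_pos hδ₀, by positivity, fun i hN x x₀ κ ν₀ μ => ?_⟩
  have hnpos : (0 : ℝ) < ((nOf i : ℕ) : ℝ) := Nat.cast_pos.mpr (NeZero.pos _)
  have hn1' : (1 : ℝ) ≤ ((nOf i : ℕ) : ℝ) := by exact_mod_cast hn1 i
  have hN' : ((nOf i : ℕ) : ℝ) ≤ (N₀ : ℝ) := by exact_mod_cast hN
  have hρ : nrm (liftZ (x - x₀)) = max 1 (tdist x₀ x : ℝ) := rfl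
  have hr01 : (tdist x₀ x : ℝ) = 0 ∨ 1 ≤ (tdist x₀ x : ℝ) := by
    rcases Nat.eq_zero_or_pos (tdist x₀ x) with h0 | hpos
    · left; exact_mod_cast h0
    · right; exact_mod_cast hpos
  have h1 : ‖calG (nOf i) (hn1 i) (MOf i) a ha (x + unitVec (fine (nOf i) (MOf i)) μ, κ) (x₀, ν₀)
        - calG (nOf i) (hn1 i) (MOf i) a ha (x, κ) (x₀, ν₀)‖ ≤
      C / ((nOf i : ℕ) : ℝ) * Real.exp (-(δ₀ * (tdist (B5Blocks16.blockOf (nOf i) (MOf i) x)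
        (B5Blocks16.blockOf (nOf i) (MOf i) x₀) : ℝ))) := by
    have := locBound_shiftDiff (nOf i) (MOf i) (hn1 i) a ha (hloc i).2 μ (Pi.single (x₀, ν₀) 1)
      (B5Blocks16.blockOf (nOf i) (MOf i) x₀) (single_supported (nOf i) (MOf i) x₀ ν₀) (x, κ)
    rw [Matrix.mulVec_single_one, Pi.norm_single, norm_one, mul_one] at this
    exact this
  have h2 := exp_block_le_exp_fine (nOf i) (MOf i) hδ₀.le x x₀
  have rem := remainder_profile (d := d + 1) (by omega) (B := (1 : ℝ)) hδ₀ hn1' zero_le_one hr01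
  rw [← hρ, one_mul, one_mul, show d + 1 - 2 = d - 1 by omega] at rem
  have hnd : 1 / ((nOf i : ℕ) : ℝ) * Real.exp (-(δ₀ * (tdist x₀ x : ℝ) / ((nOf i : ℕ) : ℝ))) =
      ((nOf i : ℕ) : ℝ) ^ d * ((1 / ((nOf i : ℕ) : ℝ)) ^ (d + 1) *
        Real.exp (-(δ₀ * (tdist x₀ x : ℝ) / ((nOf i : ℕ) : ℝ)))) := by
    rw [pow_succ, ← mul_assoc, ← mul_assoc, ← mul_pow, mul_one_div_cancel hnpos.ne', one_pow,
      one_mul]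
  have hNd : ((nOf i : ℕ) : ℝ) ^ d ≤ (N₀ : ℝ) ^ d := pow_le_pow_left₀ hnpos.le hN' d
  calc ‖calG (nOf i) (hn1 i) (MOf i) a ha (x + unitVec (fine (nOf i) (MOf i)) μ, κ) (x₀, ν₀)
        - calG (nOf i) (hn1 i) (MOf i) a ha (x, κ) (x₀, ν₀)‖
      ≤ C / ((nOf i : ℕ) : ℝ) *
          (Real.exp δ₀ * Real.exp (-(δ₀ * (tdist x₀ x : ℝ) / ((nOf i : ℕ) : ℝ)))) :=
        h1.trans (mul_le_mul_of_nonneg_left h2 (by positivity))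
    _ = C * Real.exp δ₀ * (1 / ((nOf i : ℕ) : ℝ) *
          Real.exp (-(δ₀ * (tdist x₀ x : ℝ) / ((nOf i : ℕ) : ℝ)))) := by ring
    _ = C * Real.exp δ₀ * (((nOf i : ℕ) : ℝ) ^ d * ((1 / ((nOf i : ℕ) : ℝ)) ^ (d + 1) *
          Real.exp (-(δ₀ * (tdist x₀ x : ℝ) / ((nOf i : ℕ) : ℝ))))) := by rw [hnd]
    _ ≤ C * Real.exp δ₀ * ((N₀ : ℝ) ^ d * ((1 + (((d + 1 - 2 : ℕ) : ℝ) / (δ₀ / 2)) ^ (d - 1)) *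
          (1 / ((nOf i : ℕ) : ℝ)) ^ 2 * Real.exp (-(δ₀ / 2 / ((nOf i : ℕ) : ℝ)) * (tdist x₀ x : ℝ))
            / nrm (liftZ (x - x₀)) ^ (d - 1))) := by
        refine mul_le_mul_of_nonneg_left (mul_le_mul hNd rem (by positivity) (by positivity))
          (by positivity)
    _ = _ := by rw [show d + 1 - 2 = d - 1 by omega]; ring

/-- **THE TWO LEGS, UNIFORM IN THE INSTANCE.**  For `d ≥ 3`, ASSUMING [B5, (1.110)–(1.114)] for
the reading `fam` and [B5, (1.126)–(1.127)] for the reading `kfam` BY NAME: there are `δ > 0`,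
`A₀, A₁ ≥ 0` such that for EVERY instance `i` (every `(n, M)` of the consumer's family, no side
condition) and every pair of bonds, the `d0` and `d1` profiles hold per base point.  The cutoff
radius is chosen inside: `m = ⌊(n-6)/6⌋` when `n ≥ 24` (then `1 ≤ m ≤ n ≤ 12 m` and
`6m+6 ≤ n ≤ n M_μ`), and the bounded case `n ≤ 23` is `entry_bound_small` /
`entry_diff_bound_small`. [folklore] -/
theorem legs_uniform (hd : 3 ≤ d)
    (h12 : B5.Prop12Printed (fam nOf hn1 MOf a ha))
    (h126 : B5.Kernel126_127Printed (kfam nOf MOf)) :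
    ∃ δ A₀ A₁ : ℝ, 0 < δ ∧ 0 ≤ A₀ ∧ 0 ≤ A₁ ∧ ∀ (i : ι)
      (x x₀ : Tor (fine (nOf i) (MOf i))) (κ ν₀ : Fin d),
        ‖calG (nOf i) (hn1 i) (MOf i) a ha (x, κ) (x₀, ν₀)‖ ≤
            A₀ * (1 / ((nOf i : ℕ) : ℝ)) ^ 2 *
              Real.exp (-(δ / ((nOf i : ℕ) : ℝ)) * (tdist x₀ x : ℝ)) /
                nrm (liftZ (x - x₀)) ^ (d - 2) ∧
        ∀ μ : Fin d,
          ‖calG (nOf i) (hn1 i) (MOf i) a ha (x + unitVec (fine (nOf i) (MOf i)) μ, κ) (x₀, ν₀)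
              - calG (nOf i) (hn1 i) (MOf i) a ha (x, κ) (x₀, ν₀)‖ ≤
            A₁ * (1 / ((nOf i : ℕ) : ℝ)) ^ 2 *
              Real.exp (-(δ / ((nOf i : ℕ) : ℝ)) * (tdist x₀ x : ℝ)) /
                nrm (liftZ (x - x₀)) ^ (d - 1) := by
  obtain ⟨δ₁, A₀, A₁, hδ₁, hA₀, hA₁, hbig⟩ :=
    value_and_difference_legs nOf hn1 MOf a ha hd (R := 12) (by norm_num) h12 h126
  obtain ⟨δ₂, B₀, hδ₂, hB₀, hs0⟩ := entry_bound_small nOf hn1 MOf a ha hd 23 h12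
  obtain ⟨δ₃, B₁, hδ₃, hB₁, hs1⟩ := entry_diff_bound_small nOf hn1 MOf a ha hd 23 h12
  refine ⟨min δ₁ (min δ₂ δ₃), max A₀ B₀, max A₁ B₁, lt_min hδ₁ (lt_min hδ₂ hδ₃),
    le_max_of_le_left hA₀, le_max_of_le_left hA₁, fun i x x₀ κ ν₀ => ?_⟩
  have hnpos : (0 : ℝ) < ((nOf i : ℕ) : ℝ) := Nat.cast_pos.mpr (NeZero.pos _)
  have hr0 : (0 : ℝ) ≤ (tdist x₀ x : ℝ) := Nat.cast_nonneg _
  have hρpos : 0 < nrm (liftZ (x - x₀)) := nrm_pos _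
  have mono : ∀ {δ' : ℝ}, min δ₁ (min δ₂ δ₃) ≤ δ' →
      Real.exp (-(δ' / ((nOf i : ℕ) : ℝ)) * (tdist x₀ x : ℝ)) ≤
        Real.exp (-(min δ₁ (min δ₂ δ₃) / ((nOf i : ℕ) : ℝ)) * (tdist x₀ x : ℝ)) := by
    intro δ' hle
    refine Real.exp_le_exp.mpr ?_
    rw [neg_mul, neg_mul]
    exact neg_le_neg (mul_le_mul_of_nonneg_right (div_le_div_of_nonneg_right hle hnpos.le) hr0)
  -- generic weakening of a profile bound: rate `δ' ↦ min`, constant `A ↦ max`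
  have weaken : ∀ {v A A' δ' : ℝ} {k : ℕ}, min δ₁ (min δ₂ δ₃) ≤ δ' → 0 ≤ A → A ≤ A' →
      v ≤ A * (1 / ((nOf i : ℕ) : ℝ)) ^ 2 * Real.exp (-(δ' / ((nOf i : ℕ) : ℝ)) * (tdist x₀ x : ℝ))
        / nrm (liftZ (x - x₀)) ^ k →
      v ≤ A' * (1 / ((nOf i : ℕ) : ℝ)) ^ 2 *
        Real.exp (-(min δ₁ (min δ₂ δ₃) / ((nOf i : ℕ) : ℝ)) * (tdist x₀ x : ℝ))
        / nrm (liftZ (x - x₀)) ^ k := by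
    intro v A A' δ' k hle hA hAA' hv
    refine hv.trans (div_le_div_of_nonneg_right ?_ (by positivity))
    exact mul_le_mul (mul_le_mul_of_nonneg_right hAA' (by positivity)) (mono hle)
      (by positivity) (mul_nonneg (hA.trans hAA') (by positivity))
  by_cases h24 : 24 ≤ nOf i
  · -- large `n`: cutoff radius `m = (n - 6) / 6`
    have har : 1 ≤ (nOf i - 6) / 6 ∧ (nOf i - 6) / 6 ≤ nOf i ∧ nOf i ≤ 12 * ((nOf i - 6) / 6) ∧
        6 * ((nOf i - 6) / 6) + 6 ≤ nOf i := by omega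
    have hRm : ((nOf i : ℕ) : ℝ) ≤ 12 * (((nOf i - 6) / 6 : ℕ) : ℝ) := by exact_mod_cast har.2.2.1
    have hNm : ∀ μ, 6 * ((nOf i - 6) / 6) + 6 ≤ fine (nOf i) (MOf i) μ := fun μ =>
      har.2.2.2.trans (Nat.le_mul_of_pos_right _ (NeZero.pos (MOf i μ)))
    have hb := hbig i ((nOf i - 6) / 6) har.1 har.2.1 hRm hNm x x₀ κ ν₀
    exact ⟨weaken (min_le_left _ _) hA₀ (le_max_left _ _) hb.1,
      fun μ => weaken (min_le_left _ _) hA₁ (le_max_left _ _) (hb.2 μ)⟩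
  · have hN : nOf i ≤ 23 := by omega
    exact ⟨weaken ((min_le_right _ _).trans (min_le_left _ _)) hB₀ (le_max_right _ _)
        (hs0 i hN x x₀ κ ν₀),
      fun μ => weaken ((min_le_right _ _).trans (min_le_right _ _)) hB₁ (le_max_right _ _)
        (hs1 i hN x x₀ κ ν₀ μ)⟩

end Small

end Literature.MathematicalPhysics.QuantumFieldTheory.Balaban1983to89.Beta.VectorTailsLoc
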